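import Literature.Probability.Percolation.ZdFourArmSepGlueOne
import Literature.Probability.Percolation.ZdFiveArmQuasiMultOfSeparation
import HarnessLib

/-!
# Inward extension of Kesten's well-separated four-arm event (bond percolation on `ℤ²`), deterministic half

Topic `Literature/Probability/Percolation`; critical bond percolation on `ℤ²`
(`bondPercolation (zdGraph 2) half`). Proofs and four auxiliary event definitions (no named fact).

This is a brick of the INTERNAL half of Kesten's arm-separation theorem for the alternating
four-arm event (H. Kesten, CMP 109 (1987), §2, Lemma 5; P. Nolin, EJP 13 (2008), §4.4,
"2. Internal extremities" with Prop. 12 (i) [arXiv 0711.4948: Prop. 11 (i)]: "once well-separated,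
the arms can easily be extended"), in the tree's rendering `zdFourArmSep n N`
(`ZdFourArmSeparated.lean`): the **extension cost of the fully fenced event when the inner radius
is halved**,

  `P_{1/2}(zdFourArmSep m N) ≤ C₀ · P_{1/2}(zdFourArmSep m' N)`   (`m' ≤ m/2 ≤ 2m'`, `2m ≤ N`),

which is the hypothesis `hext` of the inward multi-scale summation
(`real_fourArmTwoClusters_le_mul_of_scheme_inner`, `ZdFourArmSeparationStep.lean`; Nolin 2008,
§4.4: "for the size `η'₀`, going from `∂S_m` to `∂S_{2m}` has a cost `C'₀` depending only on `η'₀`").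
This file is the deterministic half: inside the hole `B(m-1)` of `zdFourArmSep m N` we place, for
each of the four arms, a corridor crossing reaching the old inner fence, a short crossing and a
connector around the new inner endpoint, and a crossing of the new fence box at radius `m'`, and
we REBUILD the four structures `ZdSepOpenArmR/L`, `ZdSepDualArmT/B` at inner radius `m'`
(bodies: corridor from the column / face row `m'` to the old fence, old fence crossing, old
attaching walk reversed, old body; new inner fences from the three small crossings).  The
probabilistic half (generalised FKG, RSW) is `ZdFourArmSepInwardExtProb.lean`.

* `dualLRFaceCrossing u M h` (+ `dualLRFaceCrossingPairs`, monotonicity, locality, measurability,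
  `crossingProb_le_real_dualLRFaceCrossing`: probability `≥ crossingProb ½ M h` by self-duality
  `bondPercolation_map_dualConfig_holds`) — closed-dual LEFT–RIGHT crossings of a face box, the
  companion of the five-arm seat's top–bottom `dualFaceCrossing`;
* `exists_prefix_reach_le_sharp`, `exists_prefix_reach_ge_sharp` — prefixes of lattice walks up to
  the FIRST visit of a level (all earlier vertices strictly on one side);
* `ZdSepOpenArmR.inward`, `ZdSepOpenArmL.inward`, `ZdSepDualArmT.inward`, `ZdSepDualArmB.inward` —
  the four rebuilt fenced arms at inner radius `m'` from a fenced arm at inner radius `m` and the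
  four crossings (walk form);
* `inwardOpenEvents m m'`, `inwardDualEvents m m'` — the sixteen extension events (eight open
  rectangle crossings near the `x`-axis, eight closed-dual face crossings near the `y`-axis, all
  inside `B(m-1)`), and **`mem_zdFourArmSep_of_mem_inward`**:
  `zdFourArmSep m N ∩ inwardOpenEvents m m' ∩ inwardDualEvents m m' ⊆ zdFourArmSep m' N` on lattice
  configurations (`64 ≤ m'`, `2m' ≤ m`, `2m ≤ N`).

## References

* P. Nolin, *Near-critical percolation in two dimensions*, EJP 13 (2008), §4.3 Prop. 12 (i),
  Lemma 13, §4.4 part 2 [arXiv 0711.4948: Prop. 11, Lemma 12, pp. 12–13]. [Nolin2008]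
* H. Kesten, *Scaling relations for 2D-percolation*, CMP 109 (1987), §2, Lemma 5, (2.43).
  [KestenScalingCMP1987]

Tree: `ZdSepOpenArmR/L`, `ZdSepDualArmT/B`, `zdFourArmSep` (`ZdFiveArmSeparated.lean`,
`ZdFourArmSeparated.lean`); `ZdSepOpenArmR.exists_walk_of_innerCorridor_fine`, `tbCrossingAt'`
(`ZdFiveArmQuasiMultOfSeparation.lean`); `exists_prefix_reach_ge/le`, `exists_segment_between`,
`exists_mem_support_of_vFence/hFence`, `exists_walk_within_support`,
`exists_faceWalk_within_support` (`ZdFiveArmSeparatedGluing.lean`); `dualFaceCrossing`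
(`ZdFiveArmPointBoundOfSeparation.lean`); `lrCrossingAt`, `exists_walk_of_mem_lrCrossingAt`
(`CrossingChains.lean`); `exists_walk_of_mem_tbCrossingAt` (`AnnulusCircuitsProofs.lean`);
`mem_sqAnnulus_of_bounds`, `forall_darts_sepEdge_notMem_of_edges` (`ZdFourArmSepGlue.lean`).
-/

noncomputable section

open MeasureTheory Set SimpleGraph

namespace Literature.Probability.Percolation

open LatticeModels

/-! ### Closed-dual left–right crossings of a face box -/

section DualLR

/-- **A closed-dual left–right crossing of the translated face box** `u + ([0, M] × [0, h])`
(faces indexed by lower-left corners): a walk of faces inside the box from its left column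
`{f₀ = u₀}` to its right column `{f₀ = u₀ + M}` every step of which crosses a CLOSED primal edge
(Bollobás–Riordan 2006, Ch. 3, Lemma 1, "any rectangle", dual form). [cite: BollobasRiordan2006, Ch. 3 Lemma 1] -/
def dualLRFaceCrossing (u : Site 2) (M h : ℕ) : Set (BondConfig (Site 2)) :=
  {ω | ∃ (a b : Site 2) (W : (zdGraph 2).Walk a b), a 0 = u 0 ∧ b 0 = u 0 + M ∧
      (∀ f ∈ W.support, u 0 ≤ f 0 ∧ f 0 ≤ u 0 + M ∧ u 1 ≤ f 1 ∧ f 1 ≤ u 1 + h) ∧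
      ∀ d ∈ W.darts, sepEdge d.fst d.snd ∉ ω}

/-- The face-walk dual left–right crossing event is decreasing. [folklore] -/
theorem isLowerSet_dualLRFaceCrossing (u : Site 2) (M h : ℕ) : IsLowerSet (dualLRFaceCrossing u M h) := by
  rintro ω ω' hle ⟨a, b, W, ha, hb, hs, hd⟩
  exact ⟨a, b, W, ha, hb, hs, fun d hd' he => hd d hd' (hle he)⟩

/-- The primal pairs read by `dualLRFaceCrossing u M h`: pairs of sites of the box
`[u₀, u₀ + M + 1] × [u₁, u₁ + h + 1]`. [folklore] -/
def dualLRFaceCrossingPairs (u : Site 2) (M h : ℕ) : Finset (Sym2 (Site 2)) :=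
  (Finset.Icc ![u 0, u 1] ![u 0 + M + 1, u 1 + h + 1]).sym2

/-- Coordinates of the sites of `dualLRFaceCrossingPairs`. [folklore] -/
theorem mem_Icc_dualLRFace_iff {u x : Site 2} {M h : ℕ} :
    x ∈ Finset.Icc ![u 0, u 1] ![u 0 + M + 1, u 1 + h + 1] ↔
      u 0 ≤ x 0 ∧ x 0 ≤ u 0 + M + 1 ∧ u 1 ≤ x 1 ∧ x 1 ≤ u 1 + h + 1 := by
  simp only [Finset.mem_Icc, Pi.le_def, Fin.forall_fin_two, Matrix.cons_val_zero, Matrix.cons_val_one]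
  tauto

/-- Sites of a pair of `dualLRFaceCrossingPairs u M h`. [folklore] -/
theorem apply_le_of_mem_dualLRFaceCrossingPairs {u : Site 2} {M h : ℕ} {e : Sym2 (Site 2)}
    (he : e ∈ dualLRFaceCrossingPairs u M h) {x : Site 2} (hx : x ∈ e) :
    u 0 ≤ x 0 ∧ x 0 ≤ u 0 + M + 1 ∧ u 1 ≤ x 1 ∧ x 1 ≤ u 1 + h + 1 :=
  mem_Icc_dualLRFace_iff.1 (Finset.mem_sym2_iff.1 he x hx)

/-- The edge crossed by a step between two faces of the box is a pair of `dualLRFaceCrossingPairs`.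
[folklore] -/
theorem sepEdge_mem_dualLRFaceCrossingPairs {u z z' : Site 2} {M h : ℕ}
    (hz : u 0 ≤ z 0 ∧ z 0 ≤ u 0 + M ∧ u 1 ≤ z 1 ∧ z 1 ≤ u 1 + h)
    (hz' : u 0 ≤ z' 0 ∧ z' 0 ≤ u 0 + M ∧ u 1 ≤ z' 1 ∧ z' 1 ≤ u 1 + h) :
    sepEdge z z' ∈ dualLRFaceCrossingPairs u M h := by
  rw [dualLRFaceCrossingPairs, Finset.mem_sym2_iff]
  intro x hx
  rw [mem_Icc_dualLRFace_iff]
  obtain ⟨⟨h0, h0'⟩, ⟨h1, h1'⟩⟩ := sepEdge_apply_le hx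
  have hm0 : u 0 ≤ max (z 0) (z' 0) := le_max_of_le_left hz.1
  have hm0' : max (z 0) (z' 0) ≤ u 0 + M := max_le hz.2.1 hz'.2.1
  have hm1 : u 1 ≤ max (z 1) (z' 1) := le_max_of_le_left hz.2.2.1
  have hm1' : max (z 1) (z' 1) ≤ u 1 + h := max_le hz.2.2.2 hz'.2.2.2
  refine ⟨?_, ?_, ?_, ?_⟩ <;> linarith

/-- **`dualLRFaceCrossing u M h` is determined by `dualLRFaceCrossingPairs u M h`.** [folklore] -/
theorem determinedBy_dualLRFaceCrossing (u : Site 2) (M h : ℕ) :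
    DeterminedBy (dualLRFaceCrossing u M h) ↑(dualLRFaceCrossingPairs u M h) := by
  suffices key : ∀ ω ω' : BondConfig (Site 2),
      ω ∩ ↑(dualLRFaceCrossingPairs u M h) = ω' ∩ ↑(dualLRFaceCrossingPairs u M h) →
      ω' ∈ dualLRFaceCrossing u M h → ω ∈ dualLRFaceCrossing u M h by
    rw [determinedBy_iff]
    exact fun ω ω' hh => ⟨key ω' ω hh.symm, key ω ω' hh⟩
  rintro ω ω' hh ⟨a, b, W, ha, hb, hs, hd⟩
  refine ⟨a, b, W, ha, hb, hs, fun d hd' he => hd d hd' (mem_of_inter_eq hh ?_ he)⟩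
  exact sepEdge_mem_dualLRFaceCrossingPairs (hs _ (W.dart_fst_mem_support_of_mem_darts hd'))
    (hs _ (W.dart_snd_mem_support_of_mem_darts hd'))

/-- The face-walk dual left–right crossing event is measurable. [folklore] -/
theorem measurableSet_dualLRFaceCrossing (u : Site 2) (M h : ℕ) : MeasurableSet (dualLRFaceCrossing u M h) :=
  (determinedBy_dualLRFaceCrossing u M h).measurableSet_of_finset

/-- A left–right crossing of the translated rectangle by the DUAL configuration gives a face walk of
`dualLRFaceCrossing` (dual-open steps cross closed primal edges). [folklore] -/
theorem preimage_dualConfig_lrCrossingAt_subset (u : Site 2) (M h : ℕ) :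
    dualConfig ⁻¹' lrCrossingAt u M h ⊆ dualLRFaceCrossing u M h := by
  intro ω hω
  obtain ⟨x, y, T, hx, hy, hT, hTe⟩ :=
    exists_walk_of_mem_lrCrossingAt (fun _ h => h.1 : dualConfig ω ⊆ (zdGraph 2).edgeSet) hω
  exact ⟨x, y, T, hx, hy, hT, (forall_edges_mem_dualConfig_iff T).1 hTe⟩

/-- **RSW input for the dual left–right face crossing**: its probability at `p = 1/2` is at least
`crossingProb ½ M h` (the law of the dual configuration under `P_{1/2}` is `P_{1/2}`,
`bondPercolation_map_dualConfig_holds`, and translation invariance). [cite: BollobasRiordan2006, Ch. 3, Lemma 1 and Cor. 3(i)] -/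
theorem crossingProb_le_real_dualLRFaceCrossing (u : Site 2) (M h : ℕ) :
    crossingProb half M h ≤ (bondPercolation (zdGraph 2) half).real (dualLRFaceCrossing u M h) := by
  have h1 : (bondPercolation (zdGraph 2) half).real (dualConfig ⁻¹' lrCrossingAt u M h) = crossingProb half M h := by
    rw [← map_measureReal_apply measurable_dualConfig (measurableSet_lrCrossingAt u M h),
      bondPercolation_map_dualConfig_holds half, symm_half, bondPercolation_real_lrCrossingAt]
  rw [← h1]
  exact measureReal_mono (preimage_dualConfig_lrCrossingAt_subset u M h)

/-- RSW lower bound for a dual left–right face crossing of aspect ratio at most `k`. [cite: BollobasRiordan2006, Ch. 3, eq. (3) and Cor. 3(i)] -/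
theorem le_real_dualLRFaceCrossing_of_rsw_ratio {k : ℕ} {c : ℝ}
    (hc : ∀ l : ℕ, 1 ≤ l → c ≤ crossingProb half (k * l - 1) (l - 1)) (u : Site 2) {M h : ℕ}
    (hM : M ≤ k * (h + 1) - 1) :
    c ≤ (bondPercolation (zdGraph 2) half).real (dualLRFaceCrossing u M h) := by
  refine le_trans ?_ (crossingProb_le_real_dualLRFaceCrossing u M h)
  have h' := hc (h + 1) (by omega)
  rw [Nat.add_sub_cancel] at h'
  exact h'.trans (crossingProb_anti_left half hM h)

/-- RSW lower bound for an open top–bottom corridor crossing `tbCrossingAt' u w h` of aspect ratio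
at most `k` (its probability is `crossingProb ½ h w`). [cite: BollobasRiordan2006, Ch. 3, eq. (3)] -/
theorem le_real_tbCrossingAt'_of_rsw_ratio {k : ℕ} {c : ℝ}
    (hc : ∀ l : ℕ, 1 ≤ l → c ≤ crossingProb half (k * l - 1) (l - 1)) (u : Site 2) {w h : ℕ}
    (hh : h ≤ k * (w + 1) - 1) :
    c ≤ (bondPercolation (zdGraph 2) half).real (tbCrossingAt' u w h) := by
  rw [tbCrossingAt', bondPercolation_real_tbCrossingAt]
  have h' := hc (w + 1) (by omega)
  rw [Nat.add_sub_cancel] at h'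
  exact h'.trans (crossingProb_anti_left half hh w)

end DualLR

/-! ### Sharp prefixes: up to the first visit of a level -/

section Sharp

variable {a b : Site 2}

/-- **Prefix down to a level, sharp form.** From `x_i ≥ c` to `x_i ≤ c`, an initial segment ends on
`{x_i = c}`, stays in `{x_i ≥ c}`, and all its steps START strictly above the level (its end is the
first visit of the level). [folklore] -/
theorem exists_prefix_reach_le_sharp (i : Fin 2) (W : (zdGraph 2).Walk a b) (c : ℤ) (ha : c ≤ a i)
    (hb : b i ≤ c) :
    ∃ (q : Site 2) (U : (zdGraph 2).Walk a q), q i = c ∧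
      (∀ z ∈ U.support, c ≤ z i ∧ z ∈ W.support) ∧ (∀ e ∈ U.edges, e ∈ W.edges) ∧
      ∀ d ∈ U.darts, c < d.fst i := by
  rcases eq_or_lt_of_le ha with hac | hac
  · exact ⟨a, Walk.nil, hac.symm, fun z hz => by
      rw [Walk.support_nil, List.mem_singleton] at hz; subst hz; exact ⟨ha, W.start_mem_support⟩,
      fun e he => by simp at he, fun d hd => by simp at hd⟩
  · obtain ⟨x, z, q₁, hxz, hz, hA, hS, hE, hlast⟩ :=
      exists_prefix_exit (A := {x : Site 2 | c < x i}) W hac (not_lt.2 hb)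
    have hzc : z i = c := by
      have h1 : c < x i := hA x q₁.end_mem_support
      have h2 : ¬ c < z i := hz
      have := zdGraph_adj_apply_le hxz i
      omega
    refine ⟨z, q₁.concat hxz, hzc, fun w hw => ?_, fun e he => ?_, fun d hd => ?_⟩
    · rw [Walk.support_concat, List.mem_append, List.mem_singleton] at hw
      rcases hw with hw | rfl
      · exact ⟨(show c < w i from hA w hw).le, hS w hw⟩
      · exact ⟨hzc.ge, W.snd_mem_support_of_mem_edges hlast⟩
    · rw [Walk.edges_concat, List.concat_eq_append, List.mem_append, List.mem_singleton] at he
      rcases he with he | rfl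
      · exact hE e he
      · exact hlast
    · rw [Walk.darts_concat, List.concat_eq_append, List.mem_append, List.mem_singleton] at hd
      rcases hd with hd | rfl
      · exact hA _ (q₁.dart_fst_mem_support_of_mem_darts hd)
      · exact hA x q₁.end_mem_support

/-- **Prefix up to a level, sharp form** (mirror image): from `x_i ≤ c` to `x_i ≥ c`, an initial
segment ends on `{x_i = c}`, stays in `{x_i ≤ c}`, and all its steps start strictly below the
level. [folklore] -/
theorem exists_prefix_reach_ge_sharp (i : Fin 2) (W : (zdGraph 2).Walk a b) (c : ℤ) (ha : a i ≤ c)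
    (hb : c ≤ b i) :
    ∃ (q : Site 2) (U : (zdGraph 2).Walk a q), q i = c ∧
      (∀ z ∈ U.support, z i ≤ c ∧ z ∈ W.support) ∧ (∀ e ∈ U.edges, e ∈ W.edges) ∧
      ∀ d ∈ U.darts, d.fst i < c := by
  rcases eq_or_lt_of_le ha with hac | hac
  · exact ⟨a, Walk.nil, hac, fun z hz => by
      rw [Walk.support_nil, List.mem_singleton] at hz; subst hz; exact ⟨ha, W.start_mem_support⟩,
      fun e he => by simp at he, fun d hd => by simp at hd⟩
  · obtain ⟨x, z, q₁, hxz, hz, hA, hS, hE, hlast⟩ :=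
      exists_prefix_exit (A := {x : Site 2 | x i < c}) W hac (not_lt.2 hb)
    have hzc : z i = c := by
      have h1 : x i < c := hA x q₁.end_mem_support
      have h2 : ¬ z i < c := hz
      have := zdGraph_adj_apply_le hxz i
      omega
    refine ⟨z, q₁.concat hxz, hzc, fun w hw => ?_, fun e he => ?_, fun d hd => ?_⟩
    · rw [Walk.support_concat, List.mem_append, List.mem_singleton] at hw
      rcases hw with hw | rfl
      · exact ⟨(show w i < c from hA w hw).le, hS w hw⟩
      · exact ⟨hzc.le, W.snd_mem_support_of_mem_edges hlast⟩
    · rw [Walk.edges_concat, List.concat_eq_append, List.mem_append, List.mem_singleton] at he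
      rcases he with he | rfl
      · exact hE e he
      · exact hlast
    · rw [Walk.darts_concat, List.concat_eq_append, List.mem_append, List.mem_singleton] at hd
      rcases hd with hd | rfl
      · exact hA _ (q₁.dart_fst_mem_support_of_mem_darts hd)
      · exact hA x q₁.end_mem_support

end Sharp

/-! ### Small bookkeeping lemmas -/

section Book

variable {ω : BondConfig (Site 2)}

/-- Steps of a face walk extracted from a face walk crossing closed edges (steps or reversed steps
of it) cross closed edges. [folklore] -/
theorem closed_of_within {a b u m : Site 2} (C : (zdGraph 2).Walk a b)
    (hC : ∀ d ∈ C.darts, sepEdge d.fst d.snd ∉ ω)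
    (U : (zdGraph 2).Walk u m) (hU : ∀ e ∈ U.darts, e ∈ C.darts ∨ e.symm ∈ C.darts) :
    ∀ d ∈ U.darts, sepEdge d.fst d.snd ∉ ω := by
  intro d hd
  rcases hU d hd with h | h
  · exact hC d h
  · have := hC _ h
    rwa [sepEdge_dart_symm] at this

/-- Endpoints of the edges crossed by a face walk inside a coordinate box. [folklore] -/
theorem sepEdge_bounds_of_faces {a b : Site 2} (W : (zdGraph 2).Walk a b) {L R B T : ℤ}
    (hW : ∀ f ∈ W.support, L ≤ f 0 ∧ f 0 ≤ R ∧ B ≤ f 1 ∧ f 1 ≤ T) :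
    ∀ d ∈ W.darts, ∀ v ∈ sepEdge d.fst d.snd, L ≤ v 0 ∧ v 0 ≤ R + 1 ∧ B ≤ v 1 ∧ v 1 ≤ T + 1 := by
  intro d hd v hv
  have h1 := hW _ (W.dart_fst_mem_support_of_mem_darts hd)
  have h2 := hW _ (W.dart_snd_mem_support_of_mem_darts hd)
  obtain ⟨⟨h0, h0'⟩, ⟨h1', h1''⟩⟩ := sepEdge_apply_le hv
  have a0 : L ≤ max (d.fst 0) (d.snd 0) := le_max_of_le_left h1.1
  have a0' : max (d.fst 0) (d.snd 0) ≤ R := max_le h1.2.1 h2.2.1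
  have a1 : B ≤ max (d.fst 1) (d.snd 1) := le_max_of_le_left h1.2.2.1
  have a1' : max (d.fst 1) (d.snd 1) ≤ T := max_le h1.2.2.2 h2.2.2.2
  refine ⟨?_, ?_, ?_, ?_⟩ <;> linarith

/-- Darts of an initial segment `takeUntil` are darts of the walk. [folklore] -/
theorem closed_takeUntil [DecidableEq (Site 2)] {a b u : Site 2} (W : (zdGraph 2).Walk a b) (hu : u ∈ W.support)
    (hW : ∀ d ∈ W.darts, sepEdge d.fst d.snd ∉ ω) :
    ∀ d ∈ (W.takeUntil u hu).darts, sepEdge d.fst d.snd ∉ ω :=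
  fun d hd => hW d (W.darts_takeUntil_subset_darts hu hd)

end Book

/-! ### Rebuilding the fenced open arms at a smaller inner radius -/

section OpenArms

variable {ω : BondConfig (Site 2)} {m m' N M : ℕ} {lo hi lo' hi' : ℤ}

/-- Assembling a fenced right arm from an old one (outer data kept) and new inner pieces: body, inner
fence crossing, inner attaching walk. [folklore] -/
def ZdSepOpenArmR.ofInnerPieces (A : ZdSepOpenArmR ω m N lo hi lo' hi') {n' : ℕ} {lo₁ hi₁ : ℤ}
    {x' : Site 2} (W' : (zdGraph 2).Walk x' A.z) (hx' : x' 0 = n' ∧ lo₁ ≤ x' 1 ∧ x' 1 ≤ hi₁)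
    (hW' : ∀ v ∈ W'.support, v ∈ sqAnnulus n' N) (hW'o : ∀ e ∈ W'.edges, e ∈ ω)
    {a' b' u' : Site 2} (V' : (zdGraph 2).Walk a' b') (P' : (zdGraph 2).Walk x' u')
    (hab' : a' 1 = x' 1 - (n' / 64 : ℕ) ∧ b' 1 = x' 1 + (n' / 64 : ℕ))
    (hV' : ∀ v ∈ V'.support, (n' : ℤ) - (n' / 8 : ℕ) ≤ v 0 ∧ v 0 + 1 ≤ n' ∧ |v 1 - x' 1| ≤ (n' / 64 : ℕ))
    (hV'o : ∀ e ∈ V'.edges, e ∈ ω) (hu' : u' ∈ V'.support)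
    (hP' : ∀ v ∈ P'.support, |v 0 - x' 0| + 1 ≤ (n' / 8 : ℕ) ∧ |v 1 - x' 1| + 1 ≤ (n' / 8 : ℕ))
    (hP'o : ∀ e ∈ P'.edges, e ∈ ω) : ZdSepOpenArmR ω n' N lo₁ hi₁ lo' hi' where
  x := x'
  z := A.z
  W := W'
  hx := hx'
  hz := A.hz
  hW := hW'
  hWo := hW'o
  a := A.a
  b := A.b
  u := A.u
  V := A.V
  P := A.P
  hab := A.hab
  hV := A.hV
  hVo := A.hVo
  hu := A.hu
  hP := A.hP
  hPo := A.hPo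
  a' := a'
  b' := b'
  u' := u'
  V' := V'
  P' := P'
  hab' := hab'
  hV' := hV'
  hV'o := hV'o
  hu' := hu'
  hP' := hP'
  hP'o := hP'o

/-- The same for fenced left arms. [folklore] -/
def ZdSepOpenArmL.ofInnerPieces (A : ZdSepOpenArmL ω m N lo hi lo' hi') {n' : ℕ} {lo₁ hi₁ : ℤ}
    {x' : Site 2} (W' : (zdGraph 2).Walk x' A.z) (hx' : x' 0 = -(n' : ℤ) ∧ lo₁ ≤ x' 1 ∧ x' 1 ≤ hi₁)
    (hW' : ∀ v ∈ W'.support, v ∈ sqAnnulus n' N) (hW'o : ∀ e ∈ W'.edges, e ∈ ω)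
    {a' b' u' : Site 2} (V' : (zdGraph 2).Walk a' b') (P' : (zdGraph 2).Walk x' u')
    (hab' : a' 1 = x' 1 - (n' / 64 : ℕ) ∧ b' 1 = x' 1 + (n' / 64 : ℕ))
    (hV' : ∀ v ∈ V'.support, -(n' : ℤ) + 1 ≤ v 0 ∧ v 0 ≤ -(n' : ℤ) + (n' / 8 : ℕ) ∧ |v 1 - x' 1| ≤ (n' / 64 : ℕ))
    (hV'o : ∀ e ∈ V'.edges, e ∈ ω) (hu' : u' ∈ V'.support)
    (hP' : ∀ v ∈ P'.support, |v 0 - x' 0| + 1 ≤ (n' / 8 : ℕ) ∧ |v 1 - x' 1| + 1 ≤ (n' / 8 : ℕ))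
    (hP'o : ∀ e ∈ P'.edges, e ∈ ω) : ZdSepOpenArmL ω n' N lo₁ hi₁ lo' hi' where
  x := x'
  z := A.z
  W := W'
  hx := hx'
  hz := A.hz
  hW := hW'
  hWo := hW'o
  a := A.a
  b := A.b
  u := A.u
  V := A.V
  P := A.P
  hab := A.hab
  hV := A.hV
  hVo := A.hVo
  hu := A.hu
  hP := A.hP
  hPo := A.hPo
  a' := a'
  b' := b'
  u' := u'
  V' := V'
  P' := P'
  hab' := hab'
  hV' := hV'
  hV'o := hV'o
  hu' := hu'
  hP' := hP'
  hP'o := hP'o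

/-- Numerical bound for the new attaching walks (right side): every site of the three pieces lies
in `[m' - m'/8 + 1, m' + m'/16] × [-m'/64, 2·m'/64]`, hence within sup-distance `< m'/8` of the new
inner endpoint `(m', s₁)`, `0 ≤ s₁ ≤ m'/64`. [folklore] -/
theorem attachBound_R {m' : ℕ} (hm' : 64 ≤ m') {v0 v1 s0 s1 : ℤ} (hs0 : s0 = m')
    (hs1 : 0 ≤ s1 ∧ s1 ≤ (m' / 64 : ℕ))
    (h0 : (m' : ℤ) - (m' / 8 : ℕ) + 1 ≤ v0) (h0' : v0 ≤ (m' : ℤ) + (m' / 16 : ℕ))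
    (h1 : -((m' / 64 : ℕ) : ℤ) ≤ v1) (h1' : v1 ≤ 2 * ((m' / 64 : ℕ) : ℤ)) :
    |v0 - s0| + 1 ≤ (m' / 8 : ℕ) ∧ |v1 - s1| + 1 ≤ (m' / 8 : ℕ) := by
  constructor
  · have : |v0 - s0| ≤ ((m' / 8 : ℕ) : ℤ) - 1 := abs_sub_le_iff.2 ⟨by omega, by omega⟩
    omega
  · have : |v1 - s1| ≤ 2 * ((m' / 64 : ℕ) : ℤ) := abs_sub_le_iff.2 ⟨by omega, by omega⟩
    omega

/-- The mirror image of `attachBound_R` for the left side (new inner endpoint `(-m', s₁)`). [folklore] -/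
theorem attachBound_L {m' : ℕ} (hm' : 64 ≤ m') {v0 v1 s0 s1 : ℤ} (hs0 : s0 = -(m' : ℤ))
    (hs1 : 0 ≤ s1 ∧ s1 ≤ (m' / 64 : ℕ))
    (h0 : -((m' : ℤ) + (m' / 16 : ℕ)) ≤ v0) (h0' : v0 ≤ -(m' : ℤ) + (m' / 8 : ℕ) - 1)
    (h1 : -((m' / 64 : ℕ) : ℤ) ≤ v1) (h1' : v1 ≤ 2 * ((m' / 64 : ℕ) : ℤ)) :
    |v0 - s0| + 1 ≤ (m' / 8 : ℕ) ∧ |v1 - s1| + 1 ≤ (m' / 8 : ℕ) := by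
  constructor
  · have : |v0 - s0| ≤ ((m' / 8 : ℕ) : ℤ) - 1 := abs_sub_le_iff.2 ⟨by omega, by omega⟩
    omega
  · have : |v1 - s1| ≤ 2 * ((m' / 64 : ℕ) : ℤ) := abs_sub_le_iff.2 ⟨by omega, by omega⟩
    omega

/-- **The new body of the right arm.**  From a fenced right arm `A` of `A_{m,N}` with inner landing
heights `[0, m/64]` and an open corridor crossing `H` of `[m', m-1] × [0, m'/64]` starting on the
column `m'` (`2m' ≤ m`, `2m ≤ N`): an open walk of `A_{m',N}` from the start of `H` to the outer
endpoint of `A` (corridor up to the old inner fence, old attaching walk reversed, old body).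
[cite: Nolin2008, §4.3, proof of Prop. 12 (i) (arXiv 0711.4948: Prop. 11)] -/
theorem ZdSepOpenArmR.exists_inwardBody (A : ZdSepOpenArmR ω m N 0 (m / 64 : ℕ) lo' hi')
    (hm' : 64 ≤ m') (hM : m' + M + 1 = m) (h2 : 2 * m' ≤ m) (hN : 2 * m ≤ N)
    {s y : Site 2} (H : (zdGraph 2).Walk s y) (hs : s 0 = m') (hy : y 0 = (m' : ℤ) + M)
    (hH : ∀ z ∈ H.support, (m' : ℤ) ≤ z 0 ∧ z 0 ≤ (m' : ℤ) + M ∧ 0 ≤ z 1 ∧ z 1 ≤ (m' / 64 : ℕ))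
    (hHo : ∀ e ∈ H.edges, e ∈ ω) :
    ∃ W' : (zdGraph 2).Walk s A.z, (∀ v ∈ W'.support, v ∈ sqAnnulus m' N) ∧ ∀ e ∈ W'.edges, e ∈ ω := by
  classical
  have hx := A.hx
  have hm'1 : 1 ≤ m' := by omega
  obtain ⟨mt, hmt, U, hUs, hUo⟩ := A.exists_walk_of_innerCorridor_fine (by simp) (by omega) H
    (by rw [hy]; omega) (by rw [hs]; omega)
    (fun z hz => ⟨by have := (hH z hz).2.1; omega, fun _ => ⟨(hH z hz).2.2.1, by
      have := (hH z hz).2.2.2; have : m' / 64 ≤ m / 64 := Nat.div_le_div_right (by omega); omega⟩⟩)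
  refine ⟨(H.takeUntil mt hmt).append (U.reverse.append A.W), fun v hv => ?_, fun e he => ?_⟩
  · rw [Walk.mem_support_append_iff, Walk.mem_support_append_iff, Walk.support_reverse,
      List.mem_reverse] at hv
    rcases hv with hv | hv | hv
    · obtain ⟨h0, h0', h1, h1'⟩ := hH v (H.support_takeUntil_subset_support hmt hv)
      exact mem_sqAnnulus_of_bounds hm'1 (by omega) (by omega) (by omega) (by omega) (Or.inl h0)
    · rcases hUs v hv with h | h
      · obtain ⟨a0, a1⟩ := A.hP' v h
        have b0 := abs_le.1 (show |v 0 - A.x 0| ≤ (m / 8 : ℕ) - 1 by omega)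
        have b1 := abs_le.1 (show |v 1 - A.x 1| ≤ (m / 8 : ℕ) - 1 by omega)
        exact mem_sqAnnulus_of_bounds hm'1 (by omega) (by omega) (by omega) (by omega) (Or.inl (by omega))
      · obtain ⟨a0, a0', a1⟩ := A.hV' v h
        have b1 := abs_le.1 a1
        exact mem_sqAnnulus_of_bounds hm'1 (by omega) (by omega) (by omega) (by omega) (Or.inl (by omega))
    · exact sqAnnulus_mono (by omega) le_rfl (A.hW v hv)
  · rw [Walk.edges_append, List.mem_append, Walk.edges_append, List.mem_append, Walk.edges_reverse,
      List.mem_reverse] at he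
    rcases he with he | he | he
    · exact hHo e (H.edges_takeUntil_subset_edges hmt he)
    · exact hUo e he
    · exact A.hWo e he

/-- **The new inner fence of the right arm.**  From the corridor crossing `H` (used only near its
start `s`, `s₀ = m'`, `0 ≤ s₁ ≤ m'/64`), an open crossing `H₀` of `[m'-m'/8+1, m'+m'/16] × [0, m'/64]`
from left to right and open top–bottom crossings `V₀` of `[m'+1, m'+m'/16] × [-m'/64, 2·m'/64]` and
`V₁` of `[m'-m'/8+1, m'-1] × [-m'/64, 2·m'/64]`: a crossing of the fence box
`[m'-m'/8, m'-1] × [s₁ - m'/64, s₁ + m'/64]` from its bottom row to its top row (a segment of `V₁`)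
and an open attaching walk from `s` to it within sup-distance `< m'/8` (along `H`, `V₀`, `H₀`: two
crossings of a rectangle in transverse directions meet, `exists_mem_support_of_vFence`).
[cite: Nolin2008, §4.2 Def. 6 (free spaces) and §4.3 proof of Prop. 12 (i) (arXiv 0711.4948)] -/
theorem exists_inwardFence_R (hm' : 64 ≤ m') {X : ℤ} (hX : (m' : ℤ) + (m' / 16 : ℕ) ≤ X)
    {s y : Site 2} (H : (zdGraph 2).Walk s y) (hs : s 0 = m') (hy : y 0 = X)
    (hH : ∀ z ∈ H.support, (m' : ℤ) ≤ z 0 ∧ z 0 ≤ X ∧ 0 ≤ z 1 ∧ z 1 ≤ (m' / 64 : ℕ))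
    (hHo : ∀ e ∈ H.edges, e ∈ ω)
    {s₀ y₀ : Site 2} (H₀ : (zdGraph 2).Walk s₀ y₀) (hs₀ : s₀ 0 = (m' : ℤ) - (m' / 8 : ℕ) + 1)
    (hy₀ : y₀ 0 = (m' : ℤ) + (m' / 16 : ℕ))
    (hH₀ : ∀ z ∈ H₀.support, (m' : ℤ) - (m' / 8 : ℕ) + 1 ≤ z 0 ∧ z 0 ≤ (m' : ℤ) + (m' / 16 : ℕ) ∧
      0 ≤ z 1 ∧ z 1 ≤ (m' / 64 : ℕ))
    (hH₀o : ∀ e ∈ H₀.edges, e ∈ ω)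
    {p₀ q₀ : Site 2} (V₀ : (zdGraph 2).Walk p₀ q₀) (hp₀ : p₀ 1 = -((m' / 64 : ℕ) : ℤ))
    (hq₀ : q₀ 1 = 2 * ((m' / 64 : ℕ) : ℤ))
    (hV₀ : ∀ z ∈ V₀.support, (m' : ℤ) + 1 ≤ z 0 ∧ z 0 ≤ (m' : ℤ) + (m' / 16 : ℕ) ∧
      -((m' / 64 : ℕ) : ℤ) ≤ z 1 ∧ z 1 ≤ 2 * ((m' / 64 : ℕ) : ℤ))
    (hV₀o : ∀ e ∈ V₀.edges, e ∈ ω)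
    {p₁ q₁ : Site 2} (V₁ : (zdGraph 2).Walk p₁ q₁) (hp₁ : p₁ 1 = -((m' / 64 : ℕ) : ℤ))
    (hq₁ : q₁ 1 = 2 * ((m' / 64 : ℕ) : ℤ))
    (hV₁ : ∀ z ∈ V₁.support, (m' : ℤ) - (m' / 8 : ℕ) + 1 ≤ z 0 ∧ z 0 + 1 ≤ (m' : ℤ) ∧
      -((m' / 64 : ℕ) : ℤ) ≤ z 1 ∧ z 1 ≤ 2 * ((m' / 64 : ℕ) : ℤ))
    (hV₁o : ∀ e ∈ V₁.edges, e ∈ ω) :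
    ∃ (a' b' u' : Site 2) (V' : (zdGraph 2).Walk a' b') (P' : (zdGraph 2).Walk s u'),
      (a' 1 = s 1 - (m' / 64 : ℕ) ∧ b' 1 = s 1 + (m' / 64 : ℕ)) ∧
      (∀ v ∈ V'.support, (m' : ℤ) - (m' / 8 : ℕ) ≤ v 0 ∧ v 0 + 1 ≤ m' ∧ |v 1 - s 1| ≤ (m' / 64 : ℕ)) ∧
      (∀ e ∈ V'.edges, e ∈ ω) ∧ u' ∈ V'.support ∧
      (∀ v ∈ P'.support, |v 0 - s 0| + 1 ≤ (m' / 8 : ℕ) ∧ |v 1 - s 1| + 1 ≤ (m' / 8 : ℕ)) ∧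
      ∀ e ∈ P'.edges, e ∈ ω := by
  classical
  have hs1 := hH s H.start_mem_support
  -- the fence crossing: the segment of `V₁` across the rows `[s₁ - m'/64, s₁ + m'/64]`
  obtain ⟨a', b', Vs, ha', hb', hVs, hVse⟩ := exists_segment_between 1 V₁ (s 1 - (m' / 64 : ℕ))
    (s 1 + (m' / 64 : ℕ)) (by rw [hp₁]; omega) (by rw [hq₁]; omega) (by omega)
  -- `H₀` up to the column `m' - 1` meets it
  obtain ⟨qh, H₀p, hqh, hH₀p, -⟩ := exists_prefix_reach_ge 0 H₀ ((m' : ℤ) - 1) (by rw [hs₀]; omega)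
    (by rw [hy₀]; omega)
  obtain ⟨u', hu'H, hu'V⟩ := exists_mem_support_of_vFence (L := (m' : ℤ) - (m' / 8 : ℕ) + 1)
    (R := (m' : ℤ) - 1) (B₀ := 0) (B₁ := ((m' / 64 : ℕ) : ℤ)) Vs
    (fun z hz => ⟨(hV₁ z (hVs z hz).2.2).1, by have := (hV₁ z (hVs z hz).2.2).2.1; omega⟩)
    (by rw [ha']; omega) (by rw [hb']; omega) (by omega) H₀p hs₀ hqh
    (fun z hz => ⟨(hH₀ z (hH₀p z hz).2).1, (hH₀p z hz).1, (hH₀ z (hH₀p z hz).2).2.2.1,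
      (hH₀ z (hH₀p z hz).2).2.2.2⟩)
  -- `H₀` between the columns `m' + 1` and `m' + m'/16` meets `V₀`
  obtain ⟨pa, pb, H₀s, hpa, hpb, hH₀s, -⟩ := exists_segment_between 0 H₀ ((m' : ℤ) + 1)
    ((m' : ℤ) + (m' / 16 : ℕ)) (by rw [hs₀]; omega) (by rw [hy₀]) (by omega)
  obtain ⟨v₁, hv₁H, hv₁V⟩ := exists_mem_support_of_vFence (L := (m' : ℤ) + 1)
    (R := (m' : ℤ) + (m' / 16 : ℕ)) (B₀ := 0) (B₁ := ((m' / 64 : ℕ) : ℤ)) V₀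
    (fun z hz => ⟨(hV₀ z hz).1, (hV₀ z hz).2.1⟩) (by rw [hp₀]; omega) (by rw [hq₀]; omega) (by omega)
    H₀s hpa hpb (fun z hz => ⟨(hH₀s z hz).1, (hH₀s z hz).2.1, (hH₀ z (hH₀s z hz).2.2).2.2.1,
      (hH₀ z (hH₀s z hz).2.2).2.2.2⟩)
  -- `H` up to the column `m' + m'/16` meets `V₀`
  obtain ⟨qH, Hp, hqH, hHp, hHpe⟩ := exists_prefix_reach_ge 0 H ((m' : ℤ) + (m' / 16 : ℕ))
    (by rw [hs]; omega) (by rw [hy]; omega)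
  obtain ⟨ra, rb, Hps, hra, hrb, hHps, -⟩ := exists_segment_between 0 Hp ((m' : ℤ) + 1)
    ((m' : ℤ) + (m' / 16 : ℕ)) (by rw [hs]; omega) (by rw [hqH]) (by omega)
  obtain ⟨v₀, hv₀H, hv₀V⟩ := exists_mem_support_of_vFence (L := (m' : ℤ) + 1)
    (R := (m' : ℤ) + (m' / 16 : ℕ)) (B₀ := 0) (B₁ := ((m' / 64 : ℕ) : ℤ)) V₀
    (fun z hz => ⟨(hV₀ z hz).1, (hV₀ z hz).2.1⟩) (by rw [hp₀]; omega) (by rw [hq₀]; omega) (by omega)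
    Hps hra hrb (fun z hz => ⟨(hHps z hz).1, (hHps z hz).2.1, (hH z ((hHp z (hHps z hz).2.2).2)).2.2.1,
      (hH z ((hHp z (hHps z hz).2.2).2)).2.2.2⟩)
  -- the attaching walk
  have hv₀Hp : v₀ ∈ Hp.support := (hHps v₀ hv₀H).2.2
  obtain ⟨X₁, hX₁s, hX₁e⟩ := exists_walk_within_support V₀ hv₀V hv₁V
  obtain ⟨X₂, hX₂s, hX₂e⟩ := exists_walk_within_support H₀ (hH₀s v₁ hv₁H).2.2 (hH₀p u' hu'H).2
  refine ⟨a', b', u', Vs, (Hp.takeUntil v₀ hv₀Hp).append (X₁.append X₂), ⟨ha', hb'⟩,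
    fun v hv => ?_, fun e he => hV₁o e (hVse e he), hu'V, fun v hv => ?_, fun e he => ?_⟩
  · obtain ⟨h1, h1', hv'⟩ := hVs v hv
    obtain ⟨h0, h0', -, -⟩ := hV₁ v hv'
    exact ⟨by omega, by omega, abs_le.2 ⟨by omega, by omega⟩⟩
  · rw [Walk.mem_support_append_iff, Walk.mem_support_append_iff] at hv
    rcases hv with hv | hv | hv
    · have h := hHp v (Hp.support_takeUntil_subset_support hv₀Hp hv)
      obtain ⟨h0, -, h1, h1'⟩ := hH v h.2
      exact attachBound_R hm' hs ⟨hs1.2.2.1, hs1.2.2.2⟩ (by omega) h.1 (by omega) (by omega)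
    · obtain ⟨h0, h0', h1, h1'⟩ := hV₀ v (hX₁s v hv)
      exact attachBound_R hm' hs ⟨hs1.2.2.1, hs1.2.2.2⟩ (by omega) h0' h1 h1'
    · obtain ⟨h0, h0', h1, h1'⟩ := hH₀ v (hX₂s v hv)
      exact attachBound_R hm' hs ⟨hs1.2.2.1, hs1.2.2.2⟩ h0 h0' (by omega) (by omega)
  · rw [Walk.edges_append, List.mem_append, Walk.edges_append, List.mem_append] at he
    rcases he with he | he | he
    · exact hHo e (hHpe e (Hp.edges_takeUntil_subset_edges hv₀Hp he))
    · exact hV₀o e (hX₁e e he)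
    · exact hH₀o e (hX₂e e he)

/-- **The right arm at inner radius `m'`** (`64 ≤ m'`, `2m' ≤ m`, `2m ≤ N`): from a fenced right arm
of `A_{m,N}` with inner landing heights `[0, m/64]` and the four crossings of
`ZdSepOpenArmR.exists_inwardBody` / `exists_inwardFence_R`, a fenced right arm of `A_{m',N}` with
inner landing heights `[0, m'/64]` and the same outer landing data. (Nolin 2008, Prop. 12 (i),
inward; Kesten 1987, Lemma 5.) [cite: Nolin2008, §4.3 Prop. 12 (i) and §4.4 part 2 (arXiv 0711.4948: Prop. 11 (i), p. 13)] -/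
theorem ZdSepOpenArmR.inward (A : ZdSepOpenArmR ω m N 0 (m / 64 : ℕ) lo' hi')
    (hm' : 64 ≤ m') (hM : m' + M + 1 = m) (h2 : 2 * m' ≤ m) (hN : 2 * m ≤ N)
    {s y : Site 2} (H : (zdGraph 2).Walk s y) (hs : s 0 = m') (hy : y 0 = (m' : ℤ) + M)
    (hH : ∀ z ∈ H.support, (m' : ℤ) ≤ z 0 ∧ z 0 ≤ (m' : ℤ) + M ∧ 0 ≤ z 1 ∧ z 1 ≤ (m' / 64 : ℕ))
    (hHo : ∀ e ∈ H.edges, e ∈ ω)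
    {s₀ y₀ : Site 2} (H₀ : (zdGraph 2).Walk s₀ y₀) (hs₀ : s₀ 0 = (m' : ℤ) - (m' / 8 : ℕ) + 1)
    (hy₀ : y₀ 0 = (m' : ℤ) + (m' / 16 : ℕ))
    (hH₀ : ∀ z ∈ H₀.support, (m' : ℤ) - (m' / 8 : ℕ) + 1 ≤ z 0 ∧ z 0 ≤ (m' : ℤ) + (m' / 16 : ℕ) ∧
      0 ≤ z 1 ∧ z 1 ≤ (m' / 64 : ℕ))
    (hH₀o : ∀ e ∈ H₀.edges, e ∈ ω)
    {p₀ q₀ : Site 2} (V₀ : (zdGraph 2).Walk p₀ q₀) (hp₀ : p₀ 1 = -((m' / 64 : ℕ) : ℤ))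
    (hq₀ : q₀ 1 = 2 * ((m' / 64 : ℕ) : ℤ))
    (hV₀ : ∀ z ∈ V₀.support, (m' : ℤ) + 1 ≤ z 0 ∧ z 0 ≤ (m' : ℤ) + (m' / 16 : ℕ) ∧
      -((m' / 64 : ℕ) : ℤ) ≤ z 1 ∧ z 1 ≤ 2 * ((m' / 64 : ℕ) : ℤ))
    (hV₀o : ∀ e ∈ V₀.edges, e ∈ ω)
    {p₁ q₁ : Site 2} (V₁ : (zdGraph 2).Walk p₁ q₁) (hp₁ : p₁ 1 = -((m' / 64 : ℕ) : ℤ))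
    (hq₁ : q₁ 1 = 2 * ((m' / 64 : ℕ) : ℤ))
    (hV₁ : ∀ z ∈ V₁.support, (m' : ℤ) - (m' / 8 : ℕ) + 1 ≤ z 0 ∧ z 0 + 1 ≤ (m' : ℤ) ∧
      -((m' / 64 : ℕ) : ℤ) ≤ z 1 ∧ z 1 ≤ 2 * ((m' / 64 : ℕ) : ℤ))
    (hV₁o : ∀ e ∈ V₁.edges, e ∈ ω) :
    Nonempty (ZdSepOpenArmR ω m' N 0 (m' / 64 : ℕ) lo' hi') := by
  have hs1 := hH s H.start_mem_support
  obtain ⟨W', hW', hW'o⟩ := A.exists_inwardBody hm' hM h2 hN H hs hy hH hHo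
  obtain ⟨a', b', u', V', P', hab', hV', hV'o, hu', hP', hP'o⟩ := exists_inwardFence_R hm' (X := (m' : ℤ) + M)
    (by omega) H hs hy hH hHo H₀ hs₀ hy₀ hH₀ hH₀o V₀ hp₀ hq₀ hV₀ hV₀o V₁ hp₁ hq₁ hV₁ hV₁o
  exact ⟨A.ofInnerPieces W' ⟨hs, hs1.2.2.1, hs1.2.2.2⟩ hW' hW'o V' P' hab' hV' hV'o hu' hP' hP'o⟩

/-- **The new body of the left arm** (mirror image of `ZdSepOpenArmR.exists_inwardBody`): the
corridor crossing `H` of `[-(m-1), -m'] × [0, m'/64]` is given from its RIGHT column `-m'`.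
[cite: Nolin2008, §4.3, proof of Prop. 12 (i) (arXiv 0711.4948: Prop. 11)] -/
theorem ZdSepOpenArmL.exists_inwardBody (A : ZdSepOpenArmL ω m N 0 (m / 64 : ℕ) lo' hi')
    (hm' : 64 ≤ m') (hM : m' + M + 1 = m) (h2 : 2 * m' ≤ m) (hN : 2 * m ≤ N)
    {s y : Site 2} (H : (zdGraph 2).Walk s y) (hs : s 0 = -(m' : ℤ)) (hy : y 0 = -((m' : ℤ) + M))
    (hH : ∀ z ∈ H.support, -((m' : ℤ) + M) ≤ z 0 ∧ z 0 ≤ -(m' : ℤ) ∧ 0 ≤ z 1 ∧ z 1 ≤ (m' / 64 : ℕ))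
    (hHo : ∀ e ∈ H.edges, e ∈ ω) :
    ∃ W' : (zdGraph 2).Walk s A.z, (∀ v ∈ W'.support, v ∈ sqAnnulus m' N) ∧ ∀ e ∈ W'.edges, e ∈ ω := by
  classical
  have hx := A.hx
  have hm'1 : 1 ≤ m' := by omega
  obtain ⟨mt, hmt, U, hUs, hUo⟩ := A.exists_walk_of_innerCorridor_fine (by simp) (by omega) H
    (by rw [hy]; omega) (by rw [hs]; omega)
    (fun z hz => ⟨by have := (hH z hz).1; omega, fun _ => ⟨(hH z hz).2.2.1, by
      have := (hH z hz).2.2.2; have : m' / 64 ≤ m / 64 := Nat.div_le_div_right (by omega); omega⟩⟩)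
  refine ⟨(H.takeUntil mt hmt).append (U.reverse.append A.W), fun v hv => ?_, fun e he => ?_⟩
  · rw [Walk.mem_support_append_iff, Walk.mem_support_append_iff, Walk.support_reverse,
      List.mem_reverse] at hv
    rcases hv with hv | hv | hv
    · obtain ⟨h0, h0', h1, h1'⟩ := hH v (H.support_takeUntil_subset_support hmt hv)
      exact mem_sqAnnulus_of_bounds hm'1 (by omega) (by omega) (by omega) (by omega) (Or.inr (Or.inl h0'))
    · rcases hUs v hv with h | h
      · obtain ⟨a0, a1⟩ := A.hP' v h
        have b0 := abs_le.1 (show |v 0 - A.x 0| ≤ (m / 8 : ℕ) - 1 by omega)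
        have b1 := abs_le.1 (show |v 1 - A.x 1| ≤ (m / 8 : ℕ) - 1 by omega)
        exact mem_sqAnnulus_of_bounds hm'1 (by omega) (by omega) (by omega) (by omega)
          (Or.inr (Or.inl (by omega)))
      · obtain ⟨a0, a0', a1⟩ := A.hV' v h
        have b1 := abs_le.1 a1
        exact mem_sqAnnulus_of_bounds hm'1 (by omega) (by omega) (by omega) (by omega)
          (Or.inr (Or.inl (by omega)))
    · exact sqAnnulus_mono (by omega) le_rfl (A.hW v hv)
  · rw [Walk.edges_append, List.mem_append, Walk.edges_append, List.mem_append, Walk.edges_reverse,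
      List.mem_reverse] at he
    rcases he with he | he | he
    · exact hHo e (H.edges_takeUntil_subset_edges hmt he)
    · exact hUo e he
    · exact A.hWo e he

/-- **The new inner fence of the left arm** (mirror image of `exists_inwardFence_R`): `H` from its
right column `-m'`, `H₀` a crossing of `[-(m'+m'/16), -m'+m'/8-1] × [0, m'/64]` given from its RIGHT
column, `V₀`, `V₁` top–bottom crossings of `[-(m'+m'/16), -m'-1] × [-m'/64, 2·m'/64]` and
`[-m'+1, -m'+m'/8-1] × [-m'/64, 2·m'/64]`. [cite: Nolin2008, §4.2 Def. 6 and §4.3 proof of Prop. 12 (i) (arXiv 0711.4948)] -/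
theorem exists_inwardFence_L (hm' : 64 ≤ m') {X : ℤ} (hX : X ≤ -((m' : ℤ) + (m' / 16 : ℕ)))
    {s y : Site 2} (H : (zdGraph 2).Walk s y) (hs : s 0 = -(m' : ℤ)) (hy : y 0 = X)
    (hH : ∀ z ∈ H.support, X ≤ z 0 ∧ z 0 ≤ -(m' : ℤ) ∧ 0 ≤ z 1 ∧ z 1 ≤ (m' / 64 : ℕ))
    (hHo : ∀ e ∈ H.edges, e ∈ ω)
    {s₀ y₀ : Site 2} (H₀ : (zdGraph 2).Walk s₀ y₀) (hs₀ : s₀ 0 = -(m' : ℤ) + (m' / 8 : ℕ) - 1)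
    (hy₀ : y₀ 0 = -((m' : ℤ) + (m' / 16 : ℕ)))
    (hH₀ : ∀ z ∈ H₀.support, -((m' : ℤ) + (m' / 16 : ℕ)) ≤ z 0 ∧ z 0 ≤ -(m' : ℤ) + (m' / 8 : ℕ) - 1 ∧
      0 ≤ z 1 ∧ z 1 ≤ (m' / 64 : ℕ))
    (hH₀o : ∀ e ∈ H₀.edges, e ∈ ω)
    {p₀ q₀ : Site 2} (V₀ : (zdGraph 2).Walk p₀ q₀) (hp₀ : p₀ 1 = -((m' / 64 : ℕ) : ℤ))
    (hq₀ : q₀ 1 = 2 * ((m' / 64 : ℕ) : ℤ))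
    (hV₀ : ∀ z ∈ V₀.support, -((m' : ℤ) + (m' / 16 : ℕ)) ≤ z 0 ∧ z 0 + 1 ≤ -(m' : ℤ) ∧
      -((m' / 64 : ℕ) : ℤ) ≤ z 1 ∧ z 1 ≤ 2 * ((m' / 64 : ℕ) : ℤ))
    (hV₀o : ∀ e ∈ V₀.edges, e ∈ ω)
    {p₁ q₁ : Site 2} (V₁ : (zdGraph 2).Walk p₁ q₁) (hp₁ : p₁ 1 = -((m' / 64 : ℕ) : ℤ))
    (hq₁ : q₁ 1 = 2 * ((m' / 64 : ℕ) : ℤ))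
    (hV₁ : ∀ z ∈ V₁.support, -(m' : ℤ) + 1 ≤ z 0 ∧ z 0 ≤ -(m' : ℤ) + (m' / 8 : ℕ) - 1 ∧
      -((m' / 64 : ℕ) : ℤ) ≤ z 1 ∧ z 1 ≤ 2 * ((m' / 64 : ℕ) : ℤ))
    (hV₁o : ∀ e ∈ V₁.edges, e ∈ ω) :
    ∃ (a' b' u' : Site 2) (V' : (zdGraph 2).Walk a' b') (P' : (zdGraph 2).Walk s u'),
      (a' 1 = s 1 - (m' / 64 : ℕ) ∧ b' 1 = s 1 + (m' / 64 : ℕ)) ∧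
      (∀ v ∈ V'.support, -(m' : ℤ) + 1 ≤ v 0 ∧ v 0 ≤ -(m' : ℤ) + (m' / 8 : ℕ) ∧ |v 1 - s 1| ≤ (m' / 64 : ℕ)) ∧
      (∀ e ∈ V'.edges, e ∈ ω) ∧ u' ∈ V'.support ∧
      (∀ v ∈ P'.support, |v 0 - s 0| + 1 ≤ (m' / 8 : ℕ) ∧ |v 1 - s 1| + 1 ≤ (m' / 8 : ℕ)) ∧
      ∀ e ∈ P'.edges, e ∈ ω := by
  classical
  have hs1 := hH s H.start_mem_support
  -- the fence crossing: the segment of `V₁` across the rows `[s₁ - m'/64, s₁ + m'/64]`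
  obtain ⟨a', b', Vs, ha', hb', hVs, hVse⟩ := exists_segment_between 1 V₁ (s 1 - (m' / 64 : ℕ))
    (s 1 + (m' / 64 : ℕ)) (by rw [hp₁]; omega) (by rw [hq₁]; omega) (by omega)
  -- `H₀` down to the column `-m' + 1` meets it
  obtain ⟨qh, H₀p, hqh, hH₀p, -⟩ := exists_prefix_reach_le 0 H₀ (-(m' : ℤ) + 1) (by rw [hs₀]; omega)
    (by rw [hy₀]; omega)
  obtain ⟨u', hu'H, hu'V⟩ := exists_mem_support_of_vFence (L := -(m' : ℤ) + 1)
    (R := -(m' : ℤ) + (m' / 8 : ℕ) - 1) (B₀ := 0) (B₁ := ((m' / 64 : ℕ) : ℤ)) Vs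
    (fun z hz => ⟨(hV₁ z (hVs z hz).2.2).1, (hV₁ z (hVs z hz).2.2).2.1⟩)
    (by rw [ha']; omega) (by rw [hb']; omega) (by omega) H₀p.reverse hqh hs₀
    (fun z hz => by
      rw [Walk.support_reverse, List.mem_reverse] at hz
      exact ⟨(hH₀p z hz).1, (hH₀ z (hH₀p z hz).2).2.1, (hH₀ z (hH₀p z hz).2).2.2.1,
        (hH₀ z (hH₀p z hz).2).2.2.2⟩)
  replace hu'H : u' ∈ H₀.support := by
    rw [Walk.support_reverse, List.mem_reverse] at hu'H; exact (hH₀p u' hu'H).2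
  -- `H₀` between the columns `-(m' + m'/16)` and `-m' - 1` meets `V₀`
  obtain ⟨pa, pb, H₀s, hpa, hpb, hH₀s, -⟩ := exists_segment_between 0 H₀.reverse (-((m' : ℤ) + (m' / 16 : ℕ)))
    (-(m' : ℤ) - 1) (by rw [hy₀]) (by rw [hs₀]; omega) (by omega)
  obtain ⟨v₁, hv₁H, hv₁V⟩ := exists_mem_support_of_vFence (L := -((m' : ℤ) + (m' / 16 : ℕ)))
    (R := -(m' : ℤ) - 1) (B₀ := 0) (B₁ := ((m' / 64 : ℕ) : ℤ)) V₀
    (fun z hz => ⟨(hV₀ z hz).1, by have := (hV₀ z hz).2.1; omega⟩) (by rw [hp₀]; omega)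
    (by rw [hq₀]; omega) (by omega)
    H₀s hpa hpb (fun z hz => by
      obtain ⟨h0, h0', hz'⟩ := hH₀s z hz
      rw [Walk.support_reverse, List.mem_reverse] at hz'
      exact ⟨h0, h0', (hH₀ z hz').2.2.1, (hH₀ z hz').2.2.2⟩)
  replace hv₁H : v₁ ∈ H₀.support := by
    have := (hH₀s v₁ hv₁H).2.2; rwa [Walk.support_reverse, List.mem_reverse] at this
  -- `H` down to the column `-(m' + m'/16)` meets `V₀`
  obtain ⟨qH, Hp, hqH, hHp, hHpe⟩ := exists_prefix_reach_le 0 H (-((m' : ℤ) + (m' / 16 : ℕ)))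
    (by rw [hs]; omega) (by rw [hy]; omega)
  obtain ⟨ra, rb, Hps, hra, hrb, hHps, -⟩ := exists_segment_between 0 Hp.reverse (-((m' : ℤ) + (m' / 16 : ℕ)))
    (-(m' : ℤ) - 1) (by rw [hqH]) (by rw [hs]; omega) (by omega)
  obtain ⟨v₀, hv₀H, hv₀V⟩ := exists_mem_support_of_vFence (L := -((m' : ℤ) + (m' / 16 : ℕ)))
    (R := -(m' : ℤ) - 1) (B₀ := 0) (B₁ := ((m' / 64 : ℕ) : ℤ)) V₀
    (fun z hz => ⟨(hV₀ z hz).1, by have := (hV₀ z hz).2.1; omega⟩) (by rw [hp₀]; omega)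
    (by rw [hq₀]; omega) (by omega)
    Hps hra hrb (fun z hz => by
      obtain ⟨h0, h0', hz'⟩ := hHps z hz
      rw [Walk.support_reverse, List.mem_reverse] at hz'
      exact ⟨h0, h0', (hH z (hHp z hz').2).2.2.1, (hH z (hHp z hz').2).2.2.2⟩)
  -- the attaching walk
  have hv₀Hp : v₀ ∈ Hp.support := by
    have := (hHps v₀ hv₀H).2.2; rwa [Walk.support_reverse, List.mem_reverse] at this
  obtain ⟨X₁, hX₁s, hX₁e⟩ := exists_walk_within_support V₀ hv₀V hv₁V
  obtain ⟨X₂, hX₂s, hX₂e⟩ := exists_walk_within_support H₀ hv₁H hu'H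
  refine ⟨a', b', u', Vs, (Hp.takeUntil v₀ hv₀Hp).append (X₁.append X₂), ⟨ha', hb'⟩,
    fun v hv => ?_, fun e he => hV₁o e (hVse e he), hu'V, fun v hv => ?_, fun e he => ?_⟩
  · obtain ⟨h1, h1', hv'⟩ := hVs v hv
    obtain ⟨h0, h0', -, -⟩ := hV₁ v hv'
    exact ⟨h0, by omega, abs_le.2 ⟨by omega, by omega⟩⟩
  · rw [Walk.mem_support_append_iff, Walk.mem_support_append_iff] at hv
    rcases hv with hv | hv | hv
    · have h := hHp v (Hp.support_takeUntil_subset_support hv₀Hp hv)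
      obtain ⟨-, h0', h1, h1'⟩ := hH v h.2
      exact attachBound_L hm' hs ⟨hs1.2.2.1, hs1.2.2.2⟩ h.1 (by omega) (by omega) (by omega)
    · obtain ⟨h0, h0', h1, h1'⟩ := hV₀ v (hX₁s v hv)
      exact attachBound_L hm' hs ⟨hs1.2.2.1, hs1.2.2.2⟩ h0 (by omega) h1 h1'
    · obtain ⟨h0, h0', h1, h1'⟩ := hH₀ v (hX₂s v hv)
      exact attachBound_L hm' hs ⟨hs1.2.2.1, hs1.2.2.2⟩ h0 h0' (by omega) (by omega)
  · rw [Walk.edges_append, List.mem_append, Walk.edges_append, List.mem_append] at he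
    rcases he with he | he | he
    · exact hHo e (hHpe e (Hp.edges_takeUntil_subset_edges hv₀Hp he))
    · exact hV₀o e (hX₁e e he)
    · exact hH₀o e (hX₂e e he)

/-- **The left arm at inner radius `m'`** (mirror image of `ZdSepOpenArmR.inward`). [cite: Nolin2008, §4.3 Prop. 12 (i) and §4.4 part 2 (arXiv 0711.4948: Prop. 11 (i), p. 13)] -/
theorem ZdSepOpenArmL.inward (A : ZdSepOpenArmL ω m N 0 (m / 64 : ℕ) lo' hi')
    (hm' : 64 ≤ m') (hM : m' + M + 1 = m) (h2 : 2 * m' ≤ m) (hN : 2 * m ≤ N)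
    {s y : Site 2} (H : (zdGraph 2).Walk s y) (hs : s 0 = -(m' : ℤ)) (hy : y 0 = -((m' : ℤ) + M))
    (hH : ∀ z ∈ H.support, -((m' : ℤ) + M) ≤ z 0 ∧ z 0 ≤ -(m' : ℤ) ∧ 0 ≤ z 1 ∧ z 1 ≤ (m' / 64 : ℕ))
    (hHo : ∀ e ∈ H.edges, e ∈ ω)
    {s₀ y₀ : Site 2} (H₀ : (zdGraph 2).Walk s₀ y₀) (hs₀ : s₀ 0 = -(m' : ℤ) + (m' / 8 : ℕ) - 1)
    (hy₀ : y₀ 0 = -((m' : ℤ) + (m' / 16 : ℕ)))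
    (hH₀ : ∀ z ∈ H₀.support, -((m' : ℤ) + (m' / 16 : ℕ)) ≤ z 0 ∧ z 0 ≤ -(m' : ℤ) + (m' / 8 : ℕ) - 1 ∧
      0 ≤ z 1 ∧ z 1 ≤ (m' / 64 : ℕ))
    (hH₀o : ∀ e ∈ H₀.edges, e ∈ ω)
    {p₀ q₀ : Site 2} (V₀ : (zdGraph 2).Walk p₀ q₀) (hp₀ : p₀ 1 = -((m' / 64 : ℕ) : ℤ))
    (hq₀ : q₀ 1 = 2 * ((m' / 64 : ℕ) : ℤ))
    (hV₀ : ∀ z ∈ V₀.support, -((m' : ℤ) + (m' / 16 : ℕ)) ≤ z 0 ∧ z 0 + 1 ≤ -(m' : ℤ) ∧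
      -((m' / 64 : ℕ) : ℤ) ≤ z 1 ∧ z 1 ≤ 2 * ((m' / 64 : ℕ) : ℤ))
    (hV₀o : ∀ e ∈ V₀.edges, e ∈ ω)
    {p₁ q₁ : Site 2} (V₁ : (zdGraph 2).Walk p₁ q₁) (hp₁ : p₁ 1 = -((m' / 64 : ℕ) : ℤ))
    (hq₁ : q₁ 1 = 2 * ((m' / 64 : ℕ) : ℤ))
    (hV₁ : ∀ z ∈ V₁.support, -(m' : ℤ) + 1 ≤ z 0 ∧ z 0 ≤ -(m' : ℤ) + (m' / 8 : ℕ) - 1 ∧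
      -((m' / 64 : ℕ) : ℤ) ≤ z 1 ∧ z 1 ≤ 2 * ((m' / 64 : ℕ) : ℤ))
    (hV₁o : ∀ e ∈ V₁.edges, e ∈ ω) :
    Nonempty (ZdSepOpenArmL ω m' N 0 (m' / 64 : ℕ) lo' hi') := by
  have hs1 := hH s H.start_mem_support
  obtain ⟨W', hW', hW'o⟩ := A.exists_inwardBody hm' hM h2 hN H hs hy hH hHo
  obtain ⟨a', b', u', V', P', hab', hV', hV'o, hu', hP', hP'o⟩ := exists_inwardFence_L hm'
    (X := -((m' : ℤ) + M)) (by omega) H hs hy hH hHo H₀ hs₀ hy₀ hH₀ hH₀o V₀ hp₀ hq₀ hV₀ hV₀o V₁ hp₁ hq₁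
    hV₁ hV₁o
  exact ⟨A.ofInnerPieces W' ⟨hs, hs1.2.2.1, hs1.2.2.2⟩ hW' hW'o V' P' hab' hV' hV'o hu' hP' hP'o⟩

end OpenArms

/-! ### Rebuilding the fenced dual arms at a smaller inner radius -/

section DualArms

variable {ω : BondConfig (Site 2)} {m m' N M : ℕ} {lo hi lo' hi' : ℤ}

/-- Assembling a fenced top dual arm from an old one (outer data kept) and new inner pieces.
[folklore] -/
def ZdSepDualArmT.ofInnerPieces (A : ZdSepDualArmT ω m N lo hi lo' hi') {n' : ℕ} {lo₁ hi₁ : ℤ}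
    {f' : Site 2} (Q' : (zdGraph 2).Walk f' A.g) (hf' : f' 1 + 1 = n' ∧ lo₁ ≤ f' 0 ∧ f' 0 ≤ hi₁)
    (hQ'c : ∀ d ∈ Q'.darts, sepEdge d.fst d.snd ∉ ω)
    (hQ'a : ∀ d ∈ Q'.darts, ∀ v ∈ sepEdge d.fst d.snd, v ∈ sqAnnulus n' N)
    {a' b' u' : Site 2} (C' : (zdGraph 2).Walk a' b') (P' : (zdGraph 2).Walk f' u')
    (hab' : a' 0 = f' 0 - (n' / 64 : ℕ) ∧ b' 0 = f' 0 + (n' / 64 : ℕ))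
    (hC' : ∀ w ∈ C'.support, |w 0 - f' 0| ≤ (n' / 64 : ℕ) ∧ (n' : ℤ) - 1 - (n' / 8 : ℕ) ≤ w 1 ∧ w 1 + 2 ≤ n')
    (hC'c : ∀ d ∈ C'.darts, sepEdge d.fst d.snd ∉ ω) (hu' : u' ∈ C'.support)
    (hP' : ∀ w ∈ P'.support, |w 0 - f' 0| + 1 ≤ (n' / 8 : ℕ) ∧ |w 1 - f' 1| + 1 ≤ (n' / 8 : ℕ))
    (hP'c : ∀ d ∈ P'.darts, sepEdge d.fst d.snd ∉ ω) : ZdSepDualArmT ω n' N lo₁ hi₁ lo' hi' where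
  f := f'
  g := A.g
  Q := Q'
  hf := hf'
  hg := A.hg
  hQc := hQ'c
  hQa := hQ'a
  a := A.a
  b := A.b
  u := A.u
  C := A.C
  P := A.P
  hab := A.hab
  hC := A.hC
  hCc := A.hCc
  hu := A.hu
  hP := A.hP
  hPc := A.hPc
  a' := a'
  b' := b'
  u' := u'
  C' := C'
  P' := P'
  hab' := hab'
  hC' := hC'
  hC'c := hC'c
  hu' := hu'
  hP' := hP'
  hP'c := hP'c

/-- Assembling a fenced bottom dual arm from an old one (outer data kept) and new inner pieces.
[folklore] -/
def ZdSepDualArmB.ofInnerPieces (A : ZdSepDualArmB ω m N lo hi lo' hi') {n' : ℕ} {lo₁ hi₁ : ℤ}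
    {f' : Site 2} (Q' : (zdGraph 2).Walk f' A.g) (hf' : f' 1 = -(n' : ℤ) ∧ lo₁ ≤ f' 0 ∧ f' 0 ≤ hi₁)
    (hQ'c : ∀ d ∈ Q'.darts, sepEdge d.fst d.snd ∉ ω)
    (hQ'a : ∀ d ∈ Q'.darts, ∀ v ∈ sepEdge d.fst d.snd, v ∈ sqAnnulus n' N)
    {a' b' u' : Site 2} (C' : (zdGraph 2).Walk a' b') (P' : (zdGraph 2).Walk f' u')
    (hab' : a' 0 = f' 0 - (n' / 64 : ℕ) ∧ b' 0 = f' 0 + (n' / 64 : ℕ))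
    (hC' : ∀ w ∈ C'.support, |w 0 - f' 0| ≤ (n' / 64 : ℕ) ∧ -(n' : ℤ) + 1 ≤ w 1 ∧ w 1 ≤ -(n' : ℤ) + (n' / 8 : ℕ))
    (hC'c : ∀ d ∈ C'.darts, sepEdge d.fst d.snd ∉ ω) (hu' : u' ∈ C'.support)
    (hP' : ∀ w ∈ P'.support, |w 0 - f' 0| + 1 ≤ (n' / 8 : ℕ) ∧ |w 1 - f' 1| + 1 ≤ (n' / 8 : ℕ))
    (hP'c : ∀ d ∈ P'.darts, sepEdge d.fst d.snd ∉ ω) : ZdSepDualArmB ω n' N lo₁ hi₁ lo' hi' where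
  f := f'
  g := A.g
  Q := Q'
  hf := hf'
  hg := A.hg
  hQc := hQ'c
  hQa := hQ'a
  a := A.a
  b := A.b
  u := A.u
  C := A.C
  P := A.P
  hab := A.hab
  hC := A.hC
  hCc := A.hCc
  hu := A.hu
  hP := A.hP
  hPc := A.hPc
  a' := a'
  b' := b'
  u' := u'
  C' := C'
  P' := P'
  hab' := hab'
  hC' := hC'
  hC'c := hC'c
  hu' := hu'
  hP' := hP'
  hP'c := hP'c

/-- Inner gluing, top dual arm, with the faces of the gluing walk located on the inner attaching
walk or the inner fence crossing (variant of the five-arm seat's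
`ZdSepDualArmT.exists_faceWalk_of_innerCorridor_loc`). [cite: Nolin2008, §4.3, proof of Prop. 12 (arXiv 0711.4948: Prop. 11)] -/
theorem ZdSepDualArmT.exists_faceWalk_of_innerCorridor_pieces {n : ℕ} {s y : Site 2}
    (A : ZdSepDualArmT ω n N lo hi lo' hi') (hhi : hi = lo + (n / 64 : ℕ)) (he : 1 ≤ n / 8)
    (T : (zdGraph 2).Walk s y) (hy : y 1 + 2 = n) (hs : s 1 ≤ (n : ℤ) - 1 - (n / 8 : ℕ))
    (hT : ∀ z ∈ T.support, z 1 + 2 ≤ n ∧ ((n : ℤ) - 1 - (n / 8 : ℕ) ≤ z 1 → lo ≤ z 0 ∧ z 0 ≤ lo + (n / 64 : ℕ))) :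
    ∃ m ∈ T.support, ∃ U : (zdGraph 2).Walk A.f m,
      (∀ d ∈ U.darts, sepEdge d.fst d.snd ∉ ω) ∧ ∀ z ∈ U.support, z ∈ A.P'.support ∨ z ∈ A.C'.support := by
  subst hhi
  obtain ⟨q, T₁, hq, hT₁s, -⟩ :=
    exists_prefix_reach_le 1 T.reverse ((n : ℤ) - 1 - (n / 8 : ℕ)) (by omega) hs
  have hbox : ∀ z ∈ T₁.reverse.support, lo ≤ z 0 ∧ z 0 ≤ lo + (n / 64 : ℕ) ∧
      (n : ℤ) - 1 - (n / 8 : ℕ) ≤ z 1 ∧ z 1 ≤ (n : ℤ) - 2 := by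
    intro z hz
    rw [Walk.support_reverse, List.mem_reverse] at hz
    obtain ⟨h1, h2⟩ := hT₁s z hz
    rw [Walk.support_reverse, List.mem_reverse] at h2
    obtain ⟨h3, h4⟩ := hT z h2
    exact ⟨(h4 h1).1, (h4 h1).2, h1, by omega⟩
  have hf := A.hf
  obtain ⟨m, hmT, hmC⟩ := exists_mem_support_of_hFence (L₀ := lo) (L₁ := lo + (n / 64 : ℕ))
    (B := (n : ℤ) - 1 - (n / 8 : ℕ)) (B' := (n : ℤ) - 2) A.C'
    (fun z hz => ⟨(A.hC' z hz).2.1, by have := (A.hC' z hz).2.2; omega⟩)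
    (by rw [A.hab'.1]; omega) (by rw [A.hab'.2]; omega) (by omega) T₁.reverse hq (by omega) hbox
  obtain ⟨Uc, hUcs, hUcd⟩ := exists_faceWalk_within_support A.C' A.hu' hmC
  have hmT' : m ∈ T.support := by
    rw [Walk.support_reverse, List.mem_reverse] at hmT
    have := (hT₁s m hmT).2
    rwa [Walk.support_reverse, List.mem_reverse] at this
  refine ⟨m, hmT', A.P'.append Uc, fun d hd => ?_, fun z hz => ?_⟩
  · rw [Walk.darts_append, List.mem_append] at hd
    rcases hd with hd | hd
    · exact A.hP'c d hd
    · exact closed_of_within A.C' A.hC'c Uc hUcd d hd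
  · rw [Walk.mem_support_append_iff] at hz
    rcases hz with hz | hz
    · exact Or.inl hz
    · exact Or.inr (hUcs z hz)

/-- Inner gluing, bottom dual arm, with located faces (variant of
`ZdSepDualArmB.exists_faceWalk_of_innerCorridor_loc`). [cite: Nolin2008, §4.3, proof of Prop. 12 (arXiv 0711.4948: Prop. 11)] -/
theorem ZdSepDualArmB.exists_faceWalk_of_innerCorridor_pieces {n : ℕ} {s y : Site 2}
    (A : ZdSepDualArmB ω n N lo hi lo' hi') (hhi : hi = lo + (n / 64 : ℕ)) (he : 1 ≤ n / 8)
    (T : (zdGraph 2).Walk s y) (hy : y 1 = -(n : ℤ) + 1) (hs : -(n : ℤ) + (n / 8 : ℕ) ≤ s 1)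
    (hT : ∀ z ∈ T.support, -(n : ℤ) + 1 ≤ z 1 ∧ (z 1 ≤ -(n : ℤ) + (n / 8 : ℕ) → lo ≤ z 0 ∧ z 0 ≤ lo + (n / 64 : ℕ))) :
    ∃ m ∈ T.support, ∃ U : (zdGraph 2).Walk A.f m,
      (∀ d ∈ U.darts, sepEdge d.fst d.snd ∉ ω) ∧ ∀ z ∈ U.support, z ∈ A.P'.support ∨ z ∈ A.C'.support := by
  subst hhi
  obtain ⟨q, T₁, hq, hT₁s, -⟩ :=
    exists_prefix_reach_ge 1 T.reverse (-(n : ℤ) + (n / 8 : ℕ)) (by rw [hy]; omega) hs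
  have hbox : ∀ z ∈ T₁.support, lo ≤ z 0 ∧ z 0 ≤ lo + (n / 64 : ℕ) ∧
      -(n : ℤ) + 1 ≤ z 1 ∧ z 1 ≤ -(n : ℤ) + (n / 8 : ℕ) := by
    intro z hz
    obtain ⟨h1, h2⟩ := hT₁s z hz
    rw [Walk.support_reverse, List.mem_reverse] at h2
    obtain ⟨h3, h4⟩ := hT z h2
    exact ⟨(h4 h1).1, (h4 h1).2, h3, h1⟩
  have hf := A.hf
  obtain ⟨m, hmT, hmC⟩ := exists_mem_support_of_hFence (L₀ := lo) (L₁ := lo + (n / 64 : ℕ))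
    (B := -(n : ℤ) + 1) (B' := -(n : ℤ) + (n / 8 : ℕ)) A.C'
    (fun z hz => ⟨(A.hC' z hz).2.1, (A.hC' z hz).2.2⟩)
    (by rw [A.hab'.1]; omega) (by rw [A.hab'.2]; omega) (by omega) T₁ hy hq hbox
  obtain ⟨Uc, hUcs, hUcd⟩ := exists_faceWalk_within_support A.C' A.hu' hmC
  have hmT' : m ∈ T.support := by
    have := (hT₁s m hmT).2
    rwa [Walk.support_reverse, List.mem_reverse] at this
  refine ⟨m, hmT', A.P'.append Uc, fun d hd => ?_, fun z hz => ?_⟩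
  · rw [Walk.darts_append, List.mem_append] at hd
    rcases hd with hd | hd
    · exact A.hP'c d hd
    · exact closed_of_within A.C' A.hC'c Uc hUcd d hd
  · rw [Walk.mem_support_append_iff] at hz
    rcases hz with hz | hz
    · exact Or.inl hz
    · exact Or.inr (hUcs z hz)

/-- Crossed edges of a reversed face walk, from a property of the crossed edges of the walk. [folklore] -/
theorem forall_darts_reverse_of_forall {a b : Site 2} (X : (zdGraph 2).Walk a b) {Pr : Sym2 (Site 2) → Prop}
    (hX : ∀ d ∈ X.darts, Pr (sepEdge d.fst d.snd)) : ∀ d ∈ X.reverse.darts, Pr (sepEdge d.fst d.snd) := by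
  intro d hd
  rw [Walk.darts_reverse, List.mem_reverse, List.mem_map] at hd
  obtain ⟨d', hd', rfl⟩ := hd
  rw [sepEdge_dart_symm]; exact hX d' hd'

/-- **The new body of the top dual arm.**  From a fenced top dual arm `D` of `A_{m,N}` with inner
landing columns `[0, m/64]` and a face walk `Kt` in the face columns `[0, m'/64]` from a face of the
row `m' - 1` (its only face of that row) up to the row `m - 2` crossing closed edges (`2m' ≤ m`,
`2m ≤ N`): a face walk from the start of `Kt` to the outer end face of `D`, crossing closed edges
with both endpoints in `A_{m',N}` (corridor up to the old inner fence crossing, old attaching walk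
reversed, old body). [cite: Nolin2008, §4.3, proof of Prop. 12 (i) (arXiv 0711.4948: Prop. 11)] -/
theorem ZdSepDualArmT.exists_inwardBody (D : ZdSepDualArmT ω m N 0 (m / 64 : ℕ) lo' hi')
    (hm' : 64 ≤ m') (h2 : 2 * m' ≤ m) (hN : 2 * m ≤ N)
    {q ka : Site 2} (Kt : (zdGraph 2).Walk q ka) (hq : q 1 + 1 = m') (hka : ka 1 + 2 = m)
    (hKt : ∀ f ∈ Kt.support, 0 ≤ f 0 ∧ f 0 ≤ (m' / 64 : ℕ) ∧ (m' : ℤ) - 1 ≤ f 1 ∧ f 1 + 2 ≤ m)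
    (hKtc : ∀ d ∈ Kt.darts, sepEdge d.fst d.snd ∉ ω) (hKts : ∀ d ∈ Kt.darts, (m' : ℤ) ≤ d.snd 1) :
    ∃ Q' : (zdGraph 2).Walk q D.g, (∀ d ∈ Q'.darts, sepEdge d.fst d.snd ∉ ω) ∧
      ∀ d ∈ Q'.darts, ∀ v ∈ sepEdge d.fst d.snd, v ∈ sqAnnulus m' N := by
  classical
  have hf := D.hf
  have hm'1 : 1 ≤ m' := by omega
  obtain ⟨mt, hmt, U, hUc, hUs⟩ := D.exists_faceWalk_of_innerCorridor_pieces (by simp) (by omega) Kt hka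
    (by omega)
    (fun z hz => ⟨(hKt z hz).2.2.2, fun _ => ⟨(hKt z hz).1, by
      have := (hKt z hz).2.1; have : m' / 64 ≤ m / 64 := Nat.div_le_div_right (by omega); push_cast; omega⟩⟩)
  -- bounds for the faces of the old pieces
  have hUb : ∀ z ∈ U.support, -((m / 8 : ℕ) : ℤ) ≤ z 0 ∧ z 0 ≤ (m / 64 : ℕ) + (m / 8 : ℕ) ∧
      (m : ℤ) - 1 - (m / 8 : ℕ) ≤ z 1 ∧ z 1 ≤ (m : ℤ) + (m / 8 : ℕ) - 2 := by
    intro z hz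
    rcases hUs z hz with h | h
    · obtain ⟨a0, a1⟩ := D.hP' z h
      have b0 := abs_le.1 (show |z 0 - D.f 0| ≤ (m / 8 : ℕ) - 1 by omega)
      have b1 := abs_le.1 (show |z 1 - D.f 1| ≤ (m / 8 : ℕ) - 1 by omega)
      omega
    · obtain ⟨a0, a1, a2⟩ := D.hC' z h
      have b0 := abs_le.1 a0
      omega
  refine ⟨(Kt.takeUntil mt hmt).append (U.reverse.append D.Q), fun d hd => ?_, fun d hd v hv => ?_⟩
  · rw [Walk.darts_append, List.mem_append, Walk.darts_append, List.mem_append] at hd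
    rcases hd with hd | hd | hd
    · exact closed_takeUntil Kt hmt hKtc d hd
    · exact forall_darts_reverse_sepEdge_notMem U hUc d hd
    · exact D.hQc d hd
  · rw [Walk.darts_append, List.mem_append, Walk.darts_append, List.mem_append] at hd
    rcases hd with hd | hd | hd
    · have hd' := Kt.darts_takeUntil_subset_darts hmt hd
      have h1 := hKt _ (Kt.dart_fst_mem_support_of_mem_darts hd')
      have h1' := hKt _ (Kt.dart_snd_mem_support_of_mem_darts hd')
      have h3 := hKts d hd'
      obtain ⟨⟨c0, c0'⟩, ⟨c1, c1'⟩⟩ := sepEdge_apply_le hv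
      have hv0 : 0 ≤ v 0 ∧ v 0 ≤ (m' / 64 : ℕ) + 1 := by
        rcases le_total (d.fst 0) (d.snd 0) with h | h
        · rw [max_eq_right h] at c0 c0'; exact ⟨by omega, by omega⟩
        · rw [max_eq_left h] at c0 c0'; exact ⟨by omega, by omega⟩
      have hv1 : (m' : ℤ) ≤ v 1 ∧ v 1 ≤ (m : ℤ) - 1 := by
        rcases le_total (d.fst 1) (d.snd 1) with h | h
        · rw [max_eq_right h] at c1 c1'; exact ⟨by omega, by omega⟩
        · rw [max_eq_left h] at c1 c1'; exact ⟨by omega, by omega⟩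
      exact mem_sqAnnulus_of_bounds hm'1 (by omega) (by omega) (by omega) (by omega)
        (Or.inr (Or.inr (Or.inl hv1.1)))
    · have hb := forall_darts_reverse_of_forall U
        (Pr := fun e => ∀ v ∈ e, -((m / 8 : ℕ) : ℤ) ≤ v 0 ∧ v 0 ≤ (m / 64 : ℕ) + (m / 8 : ℕ) + 1 ∧
          (m : ℤ) - 1 - (m / 8 : ℕ) ≤ v 1 ∧ v 1 ≤ (m : ℤ) + (m / 8 : ℕ) - 2 + 1)
        (sepEdge_bounds_of_faces U hUb) d hd v hv
      obtain ⟨b0, b0', b1, b1'⟩ := hb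
      exact mem_sqAnnulus_of_bounds hm'1 (by omega) (by omega) (by omega) (by omega)
        (Or.inr (Or.inr (Or.inl (by omega))))
    · exact sqAnnulus_mono (by omega) le_rfl (D.hQa d hd v hv)

/-- Numerical bound for the new attaching walks of the top dual arm: the faces of the three pieces
lie in the columns `[-m'/64, 2·m'/64]` and rows `[m' - m'/8, m' + m'/16 - 1]`. [folklore] -/
theorem attachBound_T {m' : ℕ} (hm' : 64 ≤ m') {w0 w1 q0 q1 : ℤ} (hq0 : 0 ≤ q0 ∧ q0 ≤ (m' / 64 : ℕ))
    (hq1 : q1 + 1 = m')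
    (h0 : -((m' / 64 : ℕ) : ℤ) ≤ w0) (h0' : w0 ≤ 2 * ((m' / 64 : ℕ) : ℤ))
    (h1 : (m' : ℤ) - (m' / 8 : ℕ) ≤ w1) (h1' : w1 + 1 ≤ (m' : ℤ) + (m' / 16 : ℕ)) :
    |w0 - q0| + 1 ≤ (m' / 8 : ℕ) ∧ |w1 - q1| + 1 ≤ (m' / 8 : ℕ) := by
  constructor
  · have : |w0 - q0| ≤ 2 * ((m' / 64 : ℕ) : ℤ) := abs_sub_le_iff.2 ⟨by omega, by omega⟩
    omega
  · have : |w1 - q1| ≤ ((m' / 8 : ℕ) : ℤ) - 1 := abs_sub_le_iff.2 ⟨by omega, by omega⟩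
    omega

/-- The mirror image of `attachBound_T` for the bottom dual arm: rows
`[-m' - m'/16 + 1, -m' + m'/8 - 1]`, start face row `-m'`. [folklore] -/
theorem attachBound_B {m' : ℕ} (hm' : 64 ≤ m') {w0 w1 q0 q1 : ℤ} (hq0 : 0 ≤ q0 ∧ q0 ≤ (m' / 64 : ℕ))
    (hq1 : q1 = -(m' : ℤ))
    (h0 : -((m' / 64 : ℕ) : ℤ) ≤ w0) (h0' : w0 ≤ 2 * ((m' / 64 : ℕ) : ℤ))
    (h1 : -(m' : ℤ) - (m' / 16 : ℕ) + 1 ≤ w1) (h1' : w1 + 1 ≤ -(m' : ℤ) + (m' / 8 : ℕ)) :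
    |w0 - q0| + 1 ≤ (m' / 8 : ℕ) ∧ |w1 - q1| + 1 ≤ (m' / 8 : ℕ) := by
  constructor
  · have : |w0 - q0| ≤ 2 * ((m' / 64 : ℕ) : ℤ) := abs_sub_le_iff.2 ⟨by omega, by omega⟩
    omega
  · have : |w1 - q1| ≤ ((m' / 8 : ℕ) : ℤ) - 1 := abs_sub_le_iff.2 ⟨by omega, by omega⟩
    omega

/-- **The new inner fence of the top dual arm.**  From the corridor face walk `Kt` (used near its
start face `q`, `q₁ = m' - 1`, `0 ≤ q₀ ≤ m'/64`), a closed-dual face crossing `Hd` of the face box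
`[-m'/64, 2·m'/64] × [m', m' + m'/16 - 1]` from its left column to its right column, a closed-dual face
walk `Vd` of the face columns `[0, m'/64]` from the row `m' + m'/16 - 1` down to the row `m' - m'/8`, and
a closed-dual face crossing `Cd` of `[-m'/64, 2·m'/64] × [m' - m'/8, m' - 2]` from left to right: a
closed-dual crossing of the fence box (columns `q₀ ± m'/64`, rows `[m' - 1 - m'/8, m' - 2]`) from its left
column to its right column (a segment of `Cd`) and a closed-dual attaching face walk from `q` to it
within sup-distance `< m'/8` (along `Kt`, `Hd`, `Vd`). [cite: Nolin2008, §4.2 Def. 6 (free spaces, dual colour) and §4.3 proof of Prop. 12 (i) (arXiv 0711.4948)] -/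
theorem exists_inwardFence_T (hm' : 64 ≤ m') {Y : ℤ} (hY : (m' : ℤ) + (m' / 16 : ℕ) ≤ Y + 1)
    {q ka : Site 2} (Kt : (zdGraph 2).Walk q ka) (hq : q 1 + 1 = m') (hka : ka 1 = Y)
    (hKt : ∀ f ∈ Kt.support, 0 ≤ f 0 ∧ f 0 ≤ (m' / 64 : ℕ) ∧ (m' : ℤ) - 1 ≤ f 1 ∧ f 1 ≤ Y)
    (hKtc : ∀ d ∈ Kt.darts, sepEdge d.fst d.snd ∉ ω)
    {xa xb : Site 2} (Hd : (zdGraph 2).Walk xa xb) (hxa : xa 0 = -((m' / 64 : ℕ) : ℤ))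
    (hxb : xb 0 = 2 * ((m' / 64 : ℕ) : ℤ))
    (hHd : ∀ f ∈ Hd.support, -((m' / 64 : ℕ) : ℤ) ≤ f 0 ∧ f 0 ≤ 2 * ((m' / 64 : ℕ) : ℤ) ∧
      (m' : ℤ) ≤ f 1 ∧ f 1 + 1 ≤ (m' : ℤ) + (m' / 16 : ℕ))
    (hHdc : ∀ d ∈ Hd.darts, sepEdge d.fst d.snd ∉ ω)
    {va vb : Site 2} (Vd : (zdGraph 2).Walk va vb) (hva : va 1 + 1 = (m' : ℤ) + (m' / 16 : ℕ))
    (hvb : vb 1 = (m' : ℤ) - (m' / 8 : ℕ))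
    (hVd : ∀ f ∈ Vd.support, 0 ≤ f 0 ∧ f 0 ≤ (m' / 64 : ℕ) ∧ (m' : ℤ) - (m' / 8 : ℕ) ≤ f 1 ∧
      f 1 + 1 ≤ (m' : ℤ) + (m' / 16 : ℕ))
    (hVdc : ∀ d ∈ Vd.darts, sepEdge d.fst d.snd ∉ ω)
    {ya yb : Site 2} (Cd : (zdGraph 2).Walk ya yb) (hya : ya 0 = -((m' / 64 : ℕ) : ℤ))
    (hyb : yb 0 = 2 * ((m' / 64 : ℕ) : ℤ))
    (hCd : ∀ f ∈ Cd.support, -((m' / 64 : ℕ) : ℤ) ≤ f 0 ∧ f 0 ≤ 2 * ((m' / 64 : ℕ) : ℤ) ∧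
      (m' : ℤ) - (m' / 8 : ℕ) ≤ f 1 ∧ f 1 + 2 ≤ (m' : ℤ))
    (hCdc : ∀ d ∈ Cd.darts, sepEdge d.fst d.snd ∉ ω) :
    ∃ (a' b' u' : Site 2) (C' : (zdGraph 2).Walk a' b') (P' : (zdGraph 2).Walk q u'),
      (a' 0 = q 0 - (m' / 64 : ℕ) ∧ b' 0 = q 0 + (m' / 64 : ℕ)) ∧
      (∀ w ∈ C'.support, |w 0 - q 0| ≤ (m' / 64 : ℕ) ∧ (m' : ℤ) - 1 - (m' / 8 : ℕ) ≤ w 1 ∧ w 1 + 2 ≤ m') ∧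
      (∀ d ∈ C'.darts, sepEdge d.fst d.snd ∉ ω) ∧ u' ∈ C'.support ∧
      (∀ w ∈ P'.support, |w 0 - q 0| + 1 ≤ (m' / 8 : ℕ) ∧ |w 1 - q 1| + 1 ≤ (m' / 8 : ℕ)) ∧
      ∀ d ∈ P'.darts, sepEdge d.fst d.snd ∉ ω := by
  classical
  have hq' := hKt q Kt.start_mem_support
  -- the fence crossing: the segment of `Cd` between the columns `q₀ - m'/64` and `q₀ + m'/64`
  obtain ⟨a', b', Cs, ha', hb', hCs, hCse⟩ := exists_segment_between 0 Cd (q 0 - (m' / 64 : ℕ))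
    (q 0 + (m' / 64 : ℕ)) (by rw [hya]; omega) (by rw [hyb]; omega) (by omega)
  have hCsc : ∀ d ∈ Cs.darts, sepEdge d.fst d.snd ∉ ω := forall_darts_sepEdge_notMem_of_edges Cd hCdc Cs hCse
  -- `Kt` up to the row `m' + m'/16 - 1`; its segment between the rows `m'` and `m' + m'/16 - 1` meets `Hd`
  obtain ⟨qk, Kp, hqk, hKp, hKpe⟩ := exists_prefix_reach_ge 1 Kt ((m' : ℤ) + (m' / 16 : ℕ) - 1)
    (by omega) (by rw [hka]; omega)
  obtain ⟨pa, pb, Ks, hpa, hpb, hKs, -⟩ := exists_segment_between 1 Kp (m' : ℤ)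
    ((m' : ℤ) + (m' / 16 : ℕ) - 1) (by omega) (by rw [hqk]) (by omega)
  obtain ⟨v₀, hv₀K, hv₀H⟩ := exists_mem_support_of_hFence (L₀ := 0) (L₁ := ((m' / 64 : ℕ) : ℤ))
    (B := (m' : ℤ)) (B' := (m' : ℤ) + (m' / 16 : ℕ) - 1) Hd
    (fun z hz => ⟨(hHd z hz).2.2.1, by have := (hHd z hz).2.2.2; omega⟩) (by rw [hxa]; omega)
    (by rw [hxb]; omega) (by omega) Ks hpa hpb
    (fun z hz => ⟨(hKt z (hKp z (hKs z hz).2.2).2).1, (hKt z (hKp z (hKs z hz).2.2).2).2.1,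
      (hKs z hz).1, (hKs z hz).2.1⟩)
  -- `Vd` reversed, between the rows `m'` and `m' + m'/16 - 1`, meets `Hd`
  obtain ⟨ra, rb, Vs, hra, hrb, hVs, -⟩ := exists_segment_between 1 Vd.reverse (m' : ℤ)
    ((m' : ℤ) + (m' / 16 : ℕ) - 1) (by rw [hvb]; omega) (by omega) (by omega)
  obtain ⟨v₁, hv₁V, hv₁H⟩ := exists_mem_support_of_hFence (L₀ := 0) (L₁ := ((m' / 64 : ℕ) : ℤ))
    (B := (m' : ℤ)) (B' := (m' : ℤ) + (m' / 16 : ℕ) - 1) Hd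
    (fun z hz => ⟨(hHd z hz).2.2.1, by have := (hHd z hz).2.2.2; omega⟩) (by rw [hxa]; omega)
    (by rw [hxb]; omega) (by omega) Vs hra hrb
    (fun z hz => by
      obtain ⟨h1, h1', hz'⟩ := hVs z hz
      rw [Walk.support_reverse, List.mem_reverse] at hz'
      exact ⟨(hVd z hz').1, (hVd z hz').2.1, h1, h1'⟩)
  replace hv₁V : v₁ ∈ Vd.support := by
    have := (hVs v₁ hv₁V).2.2; rwa [Walk.support_reverse, List.mem_reverse] at this
  -- the segment of the fence crossing between the columns `0` and `m'/64` meets `Vd`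
  obtain ⟨sa, sb, Css, hsa, hsb, hCss, -⟩ := exists_segment_between 0 Cs 0 ((m' / 64 : ℕ) : ℤ)
    (by rw [ha']; omega) (by rw [hb']; omega) (by omega)
  obtain ⟨u', hu'C, hu'V⟩ := exists_mem_support_of_vFence (L := 0) (R := ((m' / 64 : ℕ) : ℤ))
    (B₀ := (m' : ℤ) - (m' / 8 : ℕ)) (B₁ := (m' : ℤ) - 2) Vd.reverse
    (fun z hz => by
      rw [Walk.support_reverse, List.mem_reverse] at hz
      exact ⟨(hVd z hz).1, (hVd z hz).2.1⟩)
    hvb.le (by omega) (by omega) Css hsa hsb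
    (fun z hz => by
      obtain ⟨h0, h0', hz'⟩ := hCss z hz
      have h := hCd z (hCs z hz').2.2
      exact ⟨h0, h0', h.2.2.1, by omega⟩)
  replace hu'V : u' ∈ Vd.support := by rwa [Walk.support_reverse, List.mem_reverse] at hu'V
  have hu'Cs : u' ∈ Cs.support := (hCss u' hu'C).2.2
  -- the attaching walk
  have hv₀Kp : v₀ ∈ Kp.support := (hKs v₀ hv₀K).2.2
  obtain ⟨X₁, hX₁s, hX₁d⟩ := exists_faceWalk_within_support Hd hv₀H hv₁H
  obtain ⟨X₂, hX₂s, hX₂d⟩ := exists_faceWalk_within_support Vd hv₁V hu'V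
  have hKpc : ∀ d ∈ Kp.darts, sepEdge d.fst d.snd ∉ ω := forall_darts_sepEdge_notMem_of_edges Kt hKtc Kp hKpe
  refine ⟨a', b', u', Cs, (Kp.takeUntil v₀ hv₀Kp).append (X₁.append X₂), ⟨ha', hb'⟩,
    fun w hw => ?_, hCsc, hu'Cs, fun w hw => ?_, fun d hd => ?_⟩
  · obtain ⟨h0, h0', hw'⟩ := hCs w hw
    have h := hCd w hw'
    exact ⟨abs_le.2 ⟨by omega, by omega⟩, by omega, h.2.2.2⟩
  · rw [Walk.mem_support_append_iff, Walk.mem_support_append_iff] at hw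
    rcases hw with hw | hw | hw
    · have h := hKp w (Kp.support_takeUntil_subset_support hv₀Kp hw)
      obtain ⟨h0, h0', h1, -⟩ := hKt w h.2
      exact attachBound_T hm' ⟨hq'.1, hq'.2.1⟩ hq (by omega) (by omega) (by omega) (by omega)
    · obtain ⟨h0, h0', h1, h1'⟩ := hHd w (hX₁s w hw)
      exact attachBound_T hm' ⟨hq'.1, hq'.2.1⟩ hq h0 h0' (by omega) h1'
    · obtain ⟨h0, h0', h1, h1'⟩ := hVd w (hX₂s w hw)
      exact attachBound_T hm' ⟨hq'.1, hq'.2.1⟩ hq (by omega) (by omega) h1 h1'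
  · rw [Walk.darts_append, List.mem_append, Walk.darts_append, List.mem_append] at hd
    rcases hd with hd | hd | hd
    · exact closed_takeUntil Kp hv₀Kp hKpc d hd
    · exact closed_of_within Hd hHdc X₁ hX₁d d hd
    · exact closed_of_within Vd hVdc X₂ hX₂d d hd

/-- **The top dual arm at inner radius `m'`** (`64 ≤ m'`, `2m' ≤ m`, `2m ≤ N`): from a fenced top dual
arm of `A_{m,N}` with inner landing columns `[0, m/64]`, a closed-dual face walk `K` of the face
columns `[0, m'/64]` from the row `m - 2` down to the row `m' - 1`, and the three face crossings of
`exists_inwardFence_T`, a fenced top dual arm of `A_{m',N}` with inner landing columns `[0, m'/64]`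
and the same outer data (the new start face is the FIRST face of `K` on the row `m' - 1`).
[cite: Nolin2008, §4.3 Prop. 12 (i) and §4.4 part 2 (arXiv 0711.4948: Prop. 11 (i), p. 13)] -/
theorem ZdSepDualArmT.inward (D : ZdSepDualArmT ω m N 0 (m / 64 : ℕ) lo' hi')
    (hm' : 64 ≤ m') (h2 : 2 * m' ≤ m) (hN : 2 * m ≤ N)
    {ka kb : Site 2} (K : (zdGraph 2).Walk ka kb) (hka : ka 1 + 2 = m) (hkb : kb 1 + 1 = m')
    (hK : ∀ f ∈ K.support, 0 ≤ f 0 ∧ f 0 ≤ (m' / 64 : ℕ) ∧ (m' : ℤ) - 1 ≤ f 1 ∧ f 1 + 2 ≤ m)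
    (hKc : ∀ d ∈ K.darts, sepEdge d.fst d.snd ∉ ω)
    {xa xb : Site 2} (Hd : (zdGraph 2).Walk xa xb) (hxa : xa 0 = -((m' / 64 : ℕ) : ℤ))
    (hxb : xb 0 = 2 * ((m' / 64 : ℕ) : ℤ))
    (hHd : ∀ f ∈ Hd.support, -((m' / 64 : ℕ) : ℤ) ≤ f 0 ∧ f 0 ≤ 2 * ((m' / 64 : ℕ) : ℤ) ∧
      (m' : ℤ) ≤ f 1 ∧ f 1 + 1 ≤ (m' : ℤ) + (m' / 16 : ℕ))
    (hHdc : ∀ d ∈ Hd.darts, sepEdge d.fst d.snd ∉ ω)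
    {va vb : Site 2} (Vd : (zdGraph 2).Walk va vb) (hva : va 1 + 1 = (m' : ℤ) + (m' / 16 : ℕ))
    (hvb : vb 1 = (m' : ℤ) - (m' / 8 : ℕ))
    (hVd : ∀ f ∈ Vd.support, 0 ≤ f 0 ∧ f 0 ≤ (m' / 64 : ℕ) ∧ (m' : ℤ) - (m' / 8 : ℕ) ≤ f 1 ∧
      f 1 + 1 ≤ (m' : ℤ) + (m' / 16 : ℕ))
    (hVdc : ∀ d ∈ Vd.darts, sepEdge d.fst d.snd ∉ ω)
    {ya yb : Site 2} (Cd : (zdGraph 2).Walk ya yb) (hya : ya 0 = -((m' / 64 : ℕ) : ℤ))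
    (hyb : yb 0 = 2 * ((m' / 64 : ℕ) : ℤ))
    (hCd : ∀ f ∈ Cd.support, -((m' / 64 : ℕ) : ℤ) ≤ f 0 ∧ f 0 ≤ 2 * ((m' / 64 : ℕ) : ℤ) ∧
      (m' : ℤ) - (m' / 8 : ℕ) ≤ f 1 ∧ f 1 + 2 ≤ (m' : ℤ))
    (hCdc : ∀ d ∈ Cd.darts, sepEdge d.fst d.snd ∉ ω) :
    Nonempty (ZdSepDualArmT ω m' N 0 (m' / 64 : ℕ) lo' hi') := by
  obtain ⟨q, Kp, hq, hKps, hKpe, hKpd⟩ := exists_prefix_reach_le_sharp 1 K ((m' : ℤ) - 1) (by omega)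
    (by omega)
  have hKt : ∀ f ∈ Kp.reverse.support, 0 ≤ f 0 ∧ f 0 ≤ (m' / 64 : ℕ) ∧ (m' : ℤ) - 1 ≤ f 1 ∧ f 1 + 2 ≤ m := by
    intro f hf
    rw [Walk.support_reverse, List.mem_reverse] at hf
    exact hK f (hKps f hf).2
  have hKtc : ∀ d ∈ Kp.reverse.darts, sepEdge d.fst d.snd ∉ ω :=
    forall_darts_reverse_sepEdge_notMem Kp (forall_darts_sepEdge_notMem_of_edges K hKc Kp hKpe)
  have hKts : ∀ d ∈ Kp.reverse.darts, (m' : ℤ) ≤ d.snd 1 := by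
    intro d hd
    rw [Walk.darts_reverse, List.mem_reverse, List.mem_map] at hd
    obtain ⟨d', hd', rfl⟩ := hd
    have := hKpd d' hd'
    show (m' : ℤ) ≤ d'.fst 1
    omega
  obtain ⟨Q', hQ'c, hQ'a⟩ := D.exists_inwardBody hm' h2 hN Kp.reverse (by omega) hka hKt hKtc hKts
  obtain ⟨a', b', u', C', P', hab', hC', hC'c, hu', hP', hP'c⟩ := exists_inwardFence_T hm' (Y := ka 1)
    (by omega) Kp.reverse (by omega) rfl
    (fun f hf => by obtain ⟨h0, h0', h1, h1'⟩ := hKt f hf; exact ⟨h0, h0', h1, by omega⟩) hKtc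
    Hd hxa hxb hHd hHdc Vd hva hvb hVd hVdc Cd hya hyb hCd hCdc
  have hq' := hK q (hKps q Kp.end_mem_support).2
  exact ⟨D.ofInnerPieces Q' ⟨by omega, hq'.1, hq'.2.1⟩ hQ'c hQ'a C' P' hab' hC' hC'c hu' hP' hP'c⟩

/-- A step between two faces ending strictly below the row `r` crosses an edge both of whose
endpoints have height `≤ r`. [folklore] -/
theorem sepEdge_apply_one_le_of_step {z z' v : Site 2} (hadj : (zdGraph 2).Adj z z')
    (hv : v ∈ sepEdge z z') {r : ℤ} (hz' : z' 1 + 1 ≤ r) : v 1 ≤ r := by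
  have hc := (sepEdge_apply_le hv).2.2
  rcases stepKind_of_adj hadj with ⟨-, h1⟩ | ⟨-, h1⟩ | ⟨h1, h0⟩ | ⟨h1, h0⟩
  · rw [max_eq_left h1.le] at hc; omega
  · rw [max_eq_left h1.le] at hc; omega
  · rcases apply_one_of_mem_sepEdge_column h0 hadj hv with ⟨e1, -⟩ | ⟨e1, -⟩ <;> omega
  · rcases apply_one_of_mem_sepEdge_column h0 hadj hv with ⟨e1, e2⟩ | ⟨e1, -⟩ <;> omega

/-- **The new body of the bottom dual arm** (mirror image of `ZdSepDualArmT.exists_inwardBody`):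
`Kt` runs in the face columns `[0, m'/64]` from a face of the row `-m'` (its only face of that row)
down to the row `-m + 1`. [cite: Nolin2008, §4.3, proof of Prop. 12 (i) (arXiv 0711.4948: Prop. 11)] -/
theorem ZdSepDualArmB.exists_inwardBody (D : ZdSepDualArmB ω m N 0 (m / 64 : ℕ) lo' hi')
    (hm' : 64 ≤ m') (h2 : 2 * m' ≤ m) (hN : 2 * m ≤ N)
    {q kb : Site 2} (Kt : (zdGraph 2).Walk q kb) (hq : q 1 = -(m' : ℤ)) (hkb : kb 1 = -(m : ℤ) + 1)
    (hKt : ∀ f ∈ Kt.support, 0 ≤ f 0 ∧ f 0 ≤ (m' / 64 : ℕ) ∧ -(m : ℤ) + 1 ≤ f 1 ∧ f 1 ≤ -(m' : ℤ))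
    (hKtc : ∀ d ∈ Kt.darts, sepEdge d.fst d.snd ∉ ω) (hKts : ∀ d ∈ Kt.darts, d.snd 1 + 1 ≤ -(m' : ℤ)) :
    ∃ Q' : (zdGraph 2).Walk q D.g, (∀ d ∈ Q'.darts, sepEdge d.fst d.snd ∉ ω) ∧
      ∀ d ∈ Q'.darts, ∀ v ∈ sepEdge d.fst d.snd, v ∈ sqAnnulus m' N := by
  classical
  have hf := D.hf
  have hm'1 : 1 ≤ m' := by omega
  obtain ⟨mt, hmt, U, hUc, hUs⟩ := D.exists_faceWalk_of_innerCorridor_pieces (by simp) (by omega) Kt hkb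
    (by omega)
    (fun z hz => ⟨(hKt z hz).2.2.1, fun _ => ⟨(hKt z hz).1, by
      have := (hKt z hz).2.1; have : m' / 64 ≤ m / 64 := Nat.div_le_div_right (by omega); push_cast; omega⟩⟩)
  have hUb : ∀ z ∈ U.support, -((m / 8 : ℕ) : ℤ) ≤ z 0 ∧ z 0 ≤ (m / 64 : ℕ) + (m / 8 : ℕ) ∧
      -(m : ℤ) - (m / 8 : ℕ) + 1 ≤ z 1 ∧ z 1 ≤ -(m : ℤ) + (m / 8 : ℕ) := by
    intro z hz
    rcases hUs z hz with h | h
    · obtain ⟨a0, a1⟩ := D.hP' z h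
      have b0 := abs_le.1 (show |z 0 - D.f 0| ≤ (m / 8 : ℕ) - 1 by omega)
      have b1 := abs_le.1 (show |z 1 - D.f 1| ≤ (m / 8 : ℕ) - 1 by omega)
      omega
    · obtain ⟨a0, a1, a2⟩ := D.hC' z h
      have b0 := abs_le.1 a0
      omega
  refine ⟨(Kt.takeUntil mt hmt).append (U.reverse.append D.Q), fun d hd => ?_, fun d hd v hv => ?_⟩
  · rw [Walk.darts_append, List.mem_append, Walk.darts_append, List.mem_append] at hd
    rcases hd with hd | hd | hd
    · exact closed_takeUntil Kt hmt hKtc d hd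
    · exact forall_darts_reverse_sepEdge_notMem U hUc d hd
    · exact D.hQc d hd
  · rw [Walk.darts_append, List.mem_append, Walk.darts_append, List.mem_append] at hd
    rcases hd with hd | hd | hd
    · have hd' := Kt.darts_takeUntil_subset_darts hmt hd
      have h1 := hKt _ (Kt.dart_fst_mem_support_of_mem_darts hd')
      have h1' := hKt _ (Kt.dart_snd_mem_support_of_mem_darts hd')
      have h3 := hKts d hd'
      obtain ⟨⟨c0, c0'⟩, ⟨c1, c1'⟩⟩ := sepEdge_apply_le hv
      have hv0 : 0 ≤ v 0 ∧ v 0 ≤ (m' / 64 : ℕ) + 1 := by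
        rcases le_total (d.fst 0) (d.snd 0) with h | h
        · rw [max_eq_right h] at c0 c0'; exact ⟨by omega, by omega⟩
        · rw [max_eq_left h] at c0 c0'; exact ⟨by omega, by omega⟩
      have hv1 : -(m : ℤ) + 1 ≤ v 1 := by
        rcases le_total (d.fst 1) (d.snd 1) with h | h
        · rw [max_eq_right h] at c1; omega
        · rw [max_eq_left h] at c1; omega
      have hv1' : v 1 ≤ -(m' : ℤ) := sepEdge_apply_one_le_of_step d.adj hv h3
      exact mem_sqAnnulus_of_bounds hm'1 (by omega) (by omega) (by omega) (by omega)
        (Or.inr (Or.inr (Or.inr hv1')))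
    · have hb := forall_darts_reverse_of_forall U
        (Pr := fun e => ∀ v ∈ e, -((m / 8 : ℕ) : ℤ) ≤ v 0 ∧ v 0 ≤ (m / 64 : ℕ) + (m / 8 : ℕ) + 1 ∧
          -(m : ℤ) - (m / 8 : ℕ) + 1 ≤ v 1 ∧ v 1 ≤ -(m : ℤ) + (m / 8 : ℕ) + 1)
        (sepEdge_bounds_of_faces U hUb) d hd v hv
      obtain ⟨b0, b0', b1, b1'⟩ := hb
      exact mem_sqAnnulus_of_bounds hm'1 (by omega) (by omega) (by omega) (by omega)
        (Or.inr (Or.inr (Or.inr (by omega))))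
    · exact sqAnnulus_mono (by omega) le_rfl (D.hQa d hd v hv)

/-- **The new inner fence of the bottom dual arm** (mirror image of `exists_inwardFence_T`): `Kt` from
its start face `q` of the row `-m'` downward, `Hd` a left-to-right face crossing of
`[-m'/64, 2·m'/64] × [-m' - m'/16 + 1, -m' - 1]`, `Vd` a face walk of the columns `[0, m'/64]` from the
row `-m' + m'/8 - 1` down to the row `-m' - m'/16 + 1`, `Cd` a left-to-right face crossing of
`[-m'/64, 2·m'/64] × [-m' + 1, -m' + m'/8 - 1]`. [cite: Nolin2008, §4.2 Def. 6 and §4.3 proof of Prop. 12 (i) (arXiv 0711.4948)] -/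
theorem exists_inwardFence_B (hm' : 64 ≤ m') {Y : ℤ} (hY : Y ≤ -(m' : ℤ) - (m' / 16 : ℕ) + 1)
    {q kb : Site 2} (Kt : (zdGraph 2).Walk q kb) (hq : q 1 = -(m' : ℤ)) (hkb : kb 1 = Y)
    (hKt : ∀ f ∈ Kt.support, 0 ≤ f 0 ∧ f 0 ≤ (m' / 64 : ℕ) ∧ Y ≤ f 1 ∧ f 1 ≤ -(m' : ℤ))
    (hKtc : ∀ d ∈ Kt.darts, sepEdge d.fst d.snd ∉ ω)
    {xa xb : Site 2} (Hd : (zdGraph 2).Walk xa xb) (hxa : xa 0 = -((m' / 64 : ℕ) : ℤ))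
    (hxb : xb 0 = 2 * ((m' / 64 : ℕ) : ℤ))
    (hHd : ∀ f ∈ Hd.support, -((m' / 64 : ℕ) : ℤ) ≤ f 0 ∧ f 0 ≤ 2 * ((m' / 64 : ℕ) : ℤ) ∧
      -(m' : ℤ) - (m' / 16 : ℕ) + 1 ≤ f 1 ∧ f 1 + 1 ≤ -(m' : ℤ))
    (hHdc : ∀ d ∈ Hd.darts, sepEdge d.fst d.snd ∉ ω)
    {va vb : Site 2} (Vd : (zdGraph 2).Walk va vb) (hva : va 1 + 1 = -(m' : ℤ) + (m' / 8 : ℕ))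
    (hvb : vb 1 = -(m' : ℤ) - (m' / 16 : ℕ) + 1)
    (hVd : ∀ f ∈ Vd.support, 0 ≤ f 0 ∧ f 0 ≤ (m' / 64 : ℕ) ∧ -(m' : ℤ) - (m' / 16 : ℕ) + 1 ≤ f 1 ∧
      f 1 + 1 ≤ -(m' : ℤ) + (m' / 8 : ℕ))
    (hVdc : ∀ d ∈ Vd.darts, sepEdge d.fst d.snd ∉ ω)
    {ya yb : Site 2} (Cd : (zdGraph 2).Walk ya yb) (hya : ya 0 = -((m' / 64 : ℕ) : ℤ))
    (hyb : yb 0 = 2 * ((m' / 64 : ℕ) : ℤ))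
    (hCd : ∀ f ∈ Cd.support, -((m' / 64 : ℕ) : ℤ) ≤ f 0 ∧ f 0 ≤ 2 * ((m' / 64 : ℕ) : ℤ) ∧
      -(m' : ℤ) + 1 ≤ f 1 ∧ f 1 + 1 ≤ -(m' : ℤ) + (m' / 8 : ℕ))
    (hCdc : ∀ d ∈ Cd.darts, sepEdge d.fst d.snd ∉ ω) :
    ∃ (a' b' u' : Site 2) (C' : (zdGraph 2).Walk a' b') (P' : (zdGraph 2).Walk q u'),
      (a' 0 = q 0 - (m' / 64 : ℕ) ∧ b' 0 = q 0 + (m' / 64 : ℕ)) ∧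
      (∀ w ∈ C'.support, |w 0 - q 0| ≤ (m' / 64 : ℕ) ∧ -(m' : ℤ) + 1 ≤ w 1 ∧ w 1 ≤ -(m' : ℤ) + (m' / 8 : ℕ)) ∧
      (∀ d ∈ C'.darts, sepEdge d.fst d.snd ∉ ω) ∧ u' ∈ C'.support ∧
      (∀ w ∈ P'.support, |w 0 - q 0| + 1 ≤ (m' / 8 : ℕ) ∧ |w 1 - q 1| + 1 ≤ (m' / 8 : ℕ)) ∧
      ∀ d ∈ P'.darts, sepEdge d.fst d.snd ∉ ω := by
  classical
  have hq' := hKt q Kt.start_mem_support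
  -- the fence crossing: the segment of `Cd` between the columns `q₀ - m'/64` and `q₀ + m'/64`
  obtain ⟨a', b', Cs, ha', hb', hCs, hCse⟩ := exists_segment_between 0 Cd (q 0 - (m' / 64 : ℕ))
    (q 0 + (m' / 64 : ℕ)) (by rw [hya]; omega) (by rw [hyb]; omega) (by omega)
  have hCsc : ∀ d ∈ Cs.darts, sepEdge d.fst d.snd ∉ ω := forall_darts_sepEdge_notMem_of_edges Cd hCdc Cs hCse
  -- `Kt` down to the row `-m' - m'/16 + 1`; reversed, its segment between the rows
  -- `-m' - m'/16 + 1` and `-m' - 1` meets `Hd`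
  obtain ⟨qk, Kp, hqk, hKp, hKpe⟩ := exists_prefix_reach_le 1 Kt (-(m' : ℤ) - (m' / 16 : ℕ) + 1)
    (by omega) (by rw [hkb]; omega)
  obtain ⟨pa, pb, Ks, hpa, hpb, hKs, -⟩ := exists_segment_between 1 Kp.reverse
    (-(m' : ℤ) - (m' / 16 : ℕ) + 1) (-(m' : ℤ) - 1) (by rw [hqk]) (by omega) (by omega)
  obtain ⟨v₀, hv₀K, hv₀H⟩ := exists_mem_support_of_hFence (L₀ := 0) (L₁ := ((m' / 64 : ℕ) : ℤ))
    (B := -(m' : ℤ) - (m' / 16 : ℕ) + 1) (B' := -(m' : ℤ) - 1) Hd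
    (fun z hz => ⟨(hHd z hz).2.2.1, by have := (hHd z hz).2.2.2; omega⟩) (by rw [hxa]; omega)
    (by rw [hxb]; omega) (by omega) Ks hpa hpb
    (fun z hz => by
      obtain ⟨h1, h1', hz'⟩ := hKs z hz
      rw [Walk.support_reverse, List.mem_reverse] at hz'
      exact ⟨(hKt z (hKp z hz').2).1, (hKt z (hKp z hz').2).2.1, h1, h1'⟩)
  have hv₀Kp : v₀ ∈ Kp.support := by
    have := (hKs v₀ hv₀K).2.2; rwa [Walk.support_reverse, List.mem_reverse] at this
  -- `Vd` reversed, between the rows `-m' - m'/16 + 1` and `-m' - 1`, meets `Hd`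
  obtain ⟨ra, rb, Vs, hra, hrb, hVs, -⟩ := exists_segment_between 1 Vd.reverse
    (-(m' : ℤ) - (m' / 16 : ℕ) + 1) (-(m' : ℤ) - 1) (by rw [hvb]) (by omega) (by omega)
  obtain ⟨v₁, hv₁V, hv₁H⟩ := exists_mem_support_of_hFence (L₀ := 0) (L₁ := ((m' / 64 : ℕ) : ℤ))
    (B := -(m' : ℤ) - (m' / 16 : ℕ) + 1) (B' := -(m' : ℤ) - 1) Hd
    (fun z hz => ⟨(hHd z hz).2.2.1, by have := (hHd z hz).2.2.2; omega⟩) (by rw [hxa]; omega)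
    (by rw [hxb]; omega) (by omega) Vs hra hrb
    (fun z hz => by
      obtain ⟨h1, h1', hz'⟩ := hVs z hz
      rw [Walk.support_reverse, List.mem_reverse] at hz'
      exact ⟨(hVd z hz').1, (hVd z hz').2.1, h1, h1'⟩)
  replace hv₁V : v₁ ∈ Vd.support := by
    have := (hVs v₁ hv₁V).2.2; rwa [Walk.support_reverse, List.mem_reverse] at this
  -- the segment of the fence crossing between the columns `0` and `m'/64` meets `Vd`
  obtain ⟨sa, sb, Css, hsa, hsb, hCss, -⟩ := exists_segment_between 0 Cs 0 ((m' / 64 : ℕ) : ℤ)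
    (by rw [ha']; omega) (by rw [hb']; omega) (by omega)
  obtain ⟨u', hu'C, hu'V⟩ := exists_mem_support_of_vFence (L := 0) (R := ((m' / 64 : ℕ) : ℤ))
    (B₀ := -(m' : ℤ) + 1) (B₁ := -(m' : ℤ) + (m' / 8 : ℕ) - 1) Vd.reverse
    (fun z hz => by
      rw [Walk.support_reverse, List.mem_reverse] at hz
      exact ⟨(hVd z hz).1, (hVd z hz).2.1⟩)
    (by omega) (by omega) (by omega) Css hsa hsb
    (fun z hz => by
      obtain ⟨h0, h0', hz'⟩ := hCss z hz
      have h := hCd z (hCs z hz').2.2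
      exact ⟨h0, h0', h.2.2.1, by omega⟩)
  replace hu'V : u' ∈ Vd.support := by rwa [Walk.support_reverse, List.mem_reverse] at hu'V
  have hu'Cs : u' ∈ Cs.support := (hCss u' hu'C).2.2
  -- the attaching walk
  obtain ⟨X₁, hX₁s, hX₁d⟩ := exists_faceWalk_within_support Hd hv₀H hv₁H
  obtain ⟨X₂, hX₂s, hX₂d⟩ := exists_faceWalk_within_support Vd hv₁V hu'V
  have hKpc : ∀ d ∈ Kp.darts, sepEdge d.fst d.snd ∉ ω := forall_darts_sepEdge_notMem_of_edges Kt hKtc Kp hKpe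
  refine ⟨a', b', u', Cs, (Kp.takeUntil v₀ hv₀Kp).append (X₁.append X₂), ⟨ha', hb'⟩,
    fun w hw => ?_, hCsc, hu'Cs, fun w hw => ?_, fun d hd => ?_⟩
  · obtain ⟨h0, h0', hw'⟩ := hCs w hw
    have h := hCd w hw'
    exact ⟨abs_le.2 ⟨by omega, by omega⟩, h.2.2.1, by omega⟩
  · rw [Walk.mem_support_append_iff, Walk.mem_support_append_iff] at hw
    rcases hw with hw | hw | hw
    · have h := hKp w (Kp.support_takeUntil_subset_support hv₀Kp hw)
      obtain ⟨h0, h0', -, h1'⟩ := hKt w h.2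
      exact attachBound_B hm' ⟨hq'.1, hq'.2.1⟩ hq (by omega) (by omega) h.1 (by omega)
    · obtain ⟨h0, h0', h1, h1'⟩ := hHd w (hX₁s w hw)
      exact attachBound_B hm' ⟨hq'.1, hq'.2.1⟩ hq h0 h0' h1 (by omega)
    · obtain ⟨h0, h0', h1, h1'⟩ := hVd w (hX₂s w hw)
      exact attachBound_B hm' ⟨hq'.1, hq'.2.1⟩ hq (by omega) (by omega) h1 h1'
  · rw [Walk.darts_append, List.mem_append, Walk.darts_append, List.mem_append] at hd
    rcases hd with hd | hd | hd
    · exact closed_takeUntil Kp hv₀Kp hKpc d hd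
    · exact closed_of_within Hd hHdc X₁ hX₁d d hd
    · exact closed_of_within Vd hVdc X₂ hX₂d d hd

/-- **The bottom dual arm at inner radius `m'`** (mirror image of `ZdSepDualArmT.inward`): `K` is a
closed-dual face walk of the face columns `[0, m'/64]` from the row `-m'` down to the row `-m + 1`
(the new start face is its LAST face of the row `-m'`). [cite: Nolin2008, §4.3 Prop. 12 (i) and §4.4 part 2 (arXiv 0711.4948: Prop. 11 (i), p. 13)] -/
theorem ZdSepDualArmB.inward (D : ZdSepDualArmB ω m N 0 (m / 64 : ℕ) lo' hi')
    (hm' : 64 ≤ m') (h2 : 2 * m' ≤ m) (hN : 2 * m ≤ N)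
    {ka kb : Site 2} (K : (zdGraph 2).Walk ka kb) (hka : ka 1 = -(m' : ℤ)) (hkb : kb 1 = -(m : ℤ) + 1)
    (hK : ∀ f ∈ K.support, 0 ≤ f 0 ∧ f 0 ≤ (m' / 64 : ℕ) ∧ -(m : ℤ) + 1 ≤ f 1 ∧ f 1 ≤ -(m' : ℤ))
    (hKc : ∀ d ∈ K.darts, sepEdge d.fst d.snd ∉ ω)
    {xa xb : Site 2} (Hd : (zdGraph 2).Walk xa xb) (hxa : xa 0 = -((m' / 64 : ℕ) : ℤ))
    (hxb : xb 0 = 2 * ((m' / 64 : ℕ) : ℤ))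
    (hHd : ∀ f ∈ Hd.support, -((m' / 64 : ℕ) : ℤ) ≤ f 0 ∧ f 0 ≤ 2 * ((m' / 64 : ℕ) : ℤ) ∧
      -(m' : ℤ) - (m' / 16 : ℕ) + 1 ≤ f 1 ∧ f 1 + 1 ≤ -(m' : ℤ))
    (hHdc : ∀ d ∈ Hd.darts, sepEdge d.fst d.snd ∉ ω)
    {va vb : Site 2} (Vd : (zdGraph 2).Walk va vb) (hva : va 1 + 1 = -(m' : ℤ) + (m' / 8 : ℕ))
    (hvb : vb 1 = -(m' : ℤ) - (m' / 16 : ℕ) + 1)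
    (hVd : ∀ f ∈ Vd.support, 0 ≤ f 0 ∧ f 0 ≤ (m' / 64 : ℕ) ∧ -(m' : ℤ) - (m' / 16 : ℕ) + 1 ≤ f 1 ∧
      f 1 + 1 ≤ -(m' : ℤ) + (m' / 8 : ℕ))
    (hVdc : ∀ d ∈ Vd.darts, sepEdge d.fst d.snd ∉ ω)
    {ya yb : Site 2} (Cd : (zdGraph 2).Walk ya yb) (hya : ya 0 = -((m' / 64 : ℕ) : ℤ))
    (hyb : yb 0 = 2 * ((m' / 64 : ℕ) : ℤ))
    (hCd : ∀ f ∈ Cd.support, -((m' / 64 : ℕ) : ℤ) ≤ f 0 ∧ f 0 ≤ 2 * ((m' / 64 : ℕ) : ℤ) ∧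
      -(m' : ℤ) + 1 ≤ f 1 ∧ f 1 + 1 ≤ -(m' : ℤ) + (m' / 8 : ℕ))
    (hCdc : ∀ d ∈ Cd.darts, sepEdge d.fst d.snd ∉ ω) :
    Nonempty (ZdSepDualArmB ω m' N 0 (m' / 64 : ℕ) lo' hi') := by
  obtain ⟨q, Kp, hq, hKps, hKpe, hKpd⟩ := exists_prefix_reach_ge_sharp 1 K.reverse (-(m' : ℤ))
    (by rw [hkb]; omega) (by rw [hka])
  have hKt : ∀ f ∈ Kp.reverse.support, 0 ≤ f 0 ∧ f 0 ≤ (m' / 64 : ℕ) ∧ -(m : ℤ) + 1 ≤ f 1 ∧ f 1 ≤ -(m' : ℤ) := by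
    intro f hf
    rw [Walk.support_reverse, List.mem_reverse] at hf
    have := (hKps f hf).2
    rw [Walk.support_reverse, List.mem_reverse] at this
    exact hK f this
  have hKtc : ∀ d ∈ Kp.reverse.darts, sepEdge d.fst d.snd ∉ ω :=
    forall_darts_reverse_sepEdge_notMem Kp
      (forall_darts_sepEdge_notMem_of_edges K.reverse (forall_darts_reverse_sepEdge_notMem K hKc) Kp hKpe)
  have hKts : ∀ d ∈ Kp.reverse.darts, d.snd 1 + 1 ≤ -(m' : ℤ) := by
    intro d hd
    rw [Walk.darts_reverse, List.mem_reverse, List.mem_map] at hd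
    obtain ⟨d', hd', rfl⟩ := hd
    have := hKpd d' hd'
    show d'.fst 1 + 1 ≤ -(m' : ℤ)
    omega
  obtain ⟨Q', hQ'c, hQ'a⟩ := D.exists_inwardBody hm' h2 hN Kp.reverse hq hkb hKt hKtc hKts
  obtain ⟨a', b', u', C', P', hab', hC', hC'c, hu', hP', hP'c⟩ := exists_inwardFence_B hm' (Y := kb 1)
    (by omega) Kp.reverse hq rfl
    (fun f hf => by obtain ⟨h0, h0', h1, h1'⟩ := hKt f hf; exact ⟨h0, h0', by omega, h1'⟩) hKtc
    Hd hxa hxb hHd hHdc Vd hva hvb hVd hVdc Cd hya hyb hCd hCdc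
  have hq' := hKt q Kp.reverse.start_mem_support
  exact ⟨D.ofInnerPieces Q' ⟨hq, hq'.1, hq'.2.1⟩ hQ'c hQ'a C' P' hab' hC' hC'c hu' hP' hP'c⟩

end DualArms

/-! ### The sixteen extension events and the inclusion -/

section Events

/-- **The eight open extension events** inside the hole `B(m-1)`, near the `x`-axis: for the right
arm the corridor `[m', m-1] × [0, m'/64]` (left–right), the short crossing
`[m'-m'/8+1, m'+m'/16] × [0, m'/64]` (left–right), the connector `[m'+1, m'+m'/16] × [-m'/64, 2·m'/64]`
(top–bottom) and the new fence box crossing `[m'-m'/8+1, m'-1] × [-m'/64, 2·m'/64]` (top–bottom); the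
mirror images for the left arm. (Nolin 2008, Prop. 12 (i): extension of separated arms by RSW
corridors and the free spaces.) [cite: Nolin2008, §4.3 Prop. 12 (i) (arXiv 0711.4948: Prop. 11 (i))] -/
def inwardOpenEvents (m m' : ℕ) : Set (BondConfig (Site 2)) :=
  (lrCrossingAt ![(m' : ℤ), 0] (m - 1 - m') (m' / 64) ∩
      lrCrossingAt ![(m' : ℤ) - (m' / 8 : ℕ) + 1, 0] (m' / 8 - 1 + m' / 16) (m' / 64) ∩
    (tbCrossingAt' ![(m' : ℤ) + 1, -((m' / 64 : ℕ) : ℤ)] (m' / 16 - 1) (3 * (m' / 64)) ∩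
      tbCrossingAt' ![(m' : ℤ) - (m' / 8 : ℕ) + 1, -((m' / 64 : ℕ) : ℤ)] (m' / 8 - 2) (3 * (m' / 64)))) ∩
  (lrCrossingAt ![-((m : ℤ) - 1), 0] (m - 1 - m') (m' / 64) ∩
      lrCrossingAt ![-((m' : ℤ) + (m' / 16 : ℕ)), 0] (m' / 8 - 1 + m' / 16) (m' / 64) ∩
    (tbCrossingAt' ![-((m' : ℤ) + (m' / 16 : ℕ)), -((m' / 64 : ℕ) : ℤ)] (m' / 16 - 1) (3 * (m' / 64)) ∩
      tbCrossingAt' ![-(m' : ℤ) + 1, -((m' / 64 : ℕ) : ℤ)] (m' / 8 - 2) (3 * (m' / 64))))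

/-- **The eight closed-dual extension events** inside the hole `B(m-1)`, near the `y`-axis: for the
top dual arm the corridor (face columns `[0, m'/64]`, face rows `[m'-1, m-2]`, top–bottom), the short
crossing (`[-m'/64, 2·m'/64] × [m', m'+m'/16-1]`, left–right), the connector (columns `[0, m'/64]`, rows
`[m'-m'/8, m'+m'/16-1]`, top–bottom) and the new fence box crossing (`[-m'/64, 2·m'/64] × [m'-m'/8, m'-2]`,
left–right); the mirror images for the bottom dual arm. [cite: Nolin2008, §4.3 Prop. 12 (i) (arXiv 0711.4948: Prop. 11 (i))] -/
def inwardDualEvents (m m' : ℕ) : Set (BondConfig (Site 2)) :=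
  (dualFaceCrossing ![0, (m' : ℤ)] (m' / 64 + 1) (m - 2 - m') ∩
      dualLRFaceCrossing ![-((m' / 64 : ℕ) : ℤ), (m' : ℤ)] (3 * (m' / 64)) (m' / 16 - 1) ∩
    (dualFaceCrossing ![0, (m' : ℤ) - (m' / 8 : ℕ) + 1] (m' / 64 + 1) (m' / 16 + m' / 8 - 2) ∩
      dualLRFaceCrossing ![-((m' / 64 : ℕ) : ℤ), (m' : ℤ) - (m' / 8 : ℕ)] (3 * (m' / 64)) (m' / 8 - 2))) ∩
  (dualFaceCrossing ![0, -(m : ℤ) + 2] (m' / 64 + 1) (m - 2 - m') ∩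
      dualLRFaceCrossing ![-((m' / 64 : ℕ) : ℤ), -(m' : ℤ) - (m' / 16 : ℕ) + 1] (3 * (m' / 64)) (m' / 16 - 2) ∩
    (dualFaceCrossing ![0, -(m' : ℤ) - (m' / 16 : ℕ) + 2] (m' / 64 + 1) (m' / 16 + m' / 8 - 3) ∩
      dualLRFaceCrossing ![-((m' / 64 : ℕ) : ℤ), -(m' : ℤ) + 1] (3 * (m' / 64)) (m' / 8 - 2)))

/-- **Inward extension, deterministic half.**  On a lattice configuration, the well-separated event
of `A_{m,N}` together with the sixteen extension events gives the well-separated event of `A_{m',N}`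
(`64 ≤ m'`, `2m' ≤ m`, `2m ≤ N`). (Nolin 2008, §4.4 part 2 and Prop. 12 (i): "once well-separated, the
arms can easily be extended"; Kesten 1987, Lemma 5.) [cite: Nolin2008, §4.3 Prop. 12 (i) and §4.4 part 2 (arXiv 0711.4948: Prop. 11 (i), p. 13)] [cite: KestenScalingCMP1987, §2 Lemma 5] -/
theorem mem_zdFourArmSep_of_mem_inward {ω : BondConfig (Site 2)} (hω : ω ⊆ (zdGraph 2).edgeSet)
    {m m' N : ℕ} (hm' : 64 ≤ m') (h2 : 2 * m' ≤ m) (hN : 2 * m ≤ N)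
    (h : ω ∈ zdFourArmSep m N ∩ (inwardOpenEvents m m' ∩ inwardDualEvents m m')) :
    ω ∈ zdFourArmSep m' N := by
  obtain ⟨⟨⟨⟨A⟩, ⟨B⟩⟩, ⟨⟨T⟩, ⟨D⟩⟩⟩, ⟨⟨⟨hH, hH₀⟩, ⟨hV₀, hV₁⟩⟩, ⟨⟨hHL, hH₀L⟩, ⟨hV₀L, hV₁L⟩⟩⟩,
    ⟨⟨⟨hK, hHd⟩, ⟨hVd, hCd⟩⟩, ⟨⟨hKB, hHdB⟩, ⟨hVdB, hCdB⟩⟩⟩⟩ := h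
  refine ⟨⟨?_, ?_⟩, ⟨?_, ?_⟩⟩
  · -- right arm
    obtain ⟨s, y, H, hs, hy, hHs, hHo⟩ := exists_walk_of_mem_lrCrossingAt hω hH
    obtain ⟨s₀, y₀, H₀, hs₀, hy₀, hH₀s, hH₀o⟩ := exists_walk_of_mem_lrCrossingAt hω hH₀
    obtain ⟨p₀, q₀, V₀, hp₀, hq₀, hV₀s, hV₀o⟩ := exists_walk_of_mem_tbCrossingAt hω hV₀
    obtain ⟨p₁, q₁, V₁, hp₁, hq₁, hV₁s, hV₁o⟩ := exists_walk_of_mem_tbCrossingAt hω hV₁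
    simp only [Matrix.cons_val_zero, Matrix.cons_val_one] at hs hy hHs hs₀ hy₀ hH₀s
    simp only [Matrix.cons_val_zero, Matrix.cons_val_one] at hp₀ hq₀ hV₀s hp₁ hq₁ hV₁s
    exact A.inward hm' (M := m - 1 - m') (by omega) h2 hN H hs hy
      (fun z hz => by have h := hHs z hz; exact ⟨by omega, by omega, by omega, by omega⟩) hHo
      H₀ hs₀ (by omega) (fun z hz => by have h := hH₀s z hz; exact ⟨by omega, by omega, by omega, by omega⟩) hH₀o
      V₀ hp₀ (by omega) (fun z hz => by have h := hV₀s z hz; exact ⟨by omega, by omega, by omega, by omega⟩) hV₀o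
      V₁ hp₁ (by omega) (fun z hz => by have h := hV₁s z hz; exact ⟨by omega, by omega, by omega, by omega⟩) hV₁o
  · -- left arm
    obtain ⟨s, y, H, hs, hy, hHs, hHo⟩ := exists_walk_of_mem_lrCrossingAt hω hHL
    obtain ⟨s₀, y₀, H₀, hs₀, hy₀, hH₀s, hH₀o⟩ := exists_walk_of_mem_lrCrossingAt hω hH₀L
    obtain ⟨p₀, q₀, V₀, hp₀, hq₀, hV₀s, hV₀o⟩ := exists_walk_of_mem_tbCrossingAt hω hV₀L
    obtain ⟨p₁, q₁, V₁, hp₁, hq₁, hV₁s, hV₁o⟩ := exists_walk_of_mem_tbCrossingAt hω hV₁L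
    simp only [Matrix.cons_val_zero, Matrix.cons_val_one] at hs hy hHs hs₀ hy₀ hH₀s
    simp only [Matrix.cons_val_zero, Matrix.cons_val_one] at hp₀ hq₀ hV₀s hp₁ hq₁ hV₁s
    exact B.inward hm' (M := m - 1 - m') (by omega) h2 hN H.reverse (by omega) (by omega)
      (fun z hz => by
        rw [Walk.support_reverse, List.mem_reverse] at hz
        have h := hHs z hz; exact ⟨by omega, by omega, by omega, by omega⟩)
      (fun e he => hHo e (by rwa [Walk.edges_reverse, List.mem_reverse] at he))
      H₀.reverse (by omega) (by omega)
      (fun z hz => by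
        rw [Walk.support_reverse, List.mem_reverse] at hz
        have h := hH₀s z hz; exact ⟨by omega, by omega, by omega, by omega⟩)
      (fun e he => hH₀o e (by rwa [Walk.edges_reverse, List.mem_reverse] at he))
      V₀ hp₀ (by omega) (fun z hz => by have h := hV₀s z hz; exact ⟨by omega, by omega, by omega, by omega⟩) hV₀o
      V₁ hp₁ (by omega) (fun z hz => by have h := hV₁s z hz; exact ⟨by omega, by omega, by omega, by omega⟩) hV₁o
  · -- top dual arm
    obtain ⟨ka, kb, K, hka, hkb, hKs, hKc⟩ := hK
    obtain ⟨xa, xb, Hd, hxa, hxb, hHds, hHdc⟩ := hHd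
    obtain ⟨va, vb, Vd, hva, hvb, hVds, hVdc⟩ := hVd
    obtain ⟨ya, yb, Cd, hya, hyb, hCds, hCdc⟩ := hCd
    simp only [Matrix.cons_val_zero, Matrix.cons_val_one] at hka hkb hKs hxa hxb hHds
    simp only [Matrix.cons_val_zero, Matrix.cons_val_one] at hva hvb hVds hya hyb hCds
    exact T.inward hm' h2 hN K (by omega) (by omega)
      (fun f hf => by have h := hKs f hf; exact ⟨by omega, by omega, by omega, by omega⟩) hKc
      Hd hxa (by omega) (fun f hf => by have h := hHds f hf; exact ⟨by omega, by omega, by omega, by omega⟩) hHdc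
      Vd (by omega) (by omega) (fun f hf => by have h := hVds f hf; exact ⟨by omega, by omega, by omega, by omega⟩) hVdc
      Cd hya (by omega) (fun f hf => by have h := hCds f hf; exact ⟨by omega, by omega, by omega, by omega⟩) hCdc
  · -- bottom dual arm
    obtain ⟨ka, kb, K, hka, hkb, hKs, hKc⟩ := hKB
    obtain ⟨xa, xb, Hd, hxa, hxb, hHds, hHdc⟩ := hHdB
    obtain ⟨va, vb, Vd, hva, hvb, hVds, hVdc⟩ := hVdB
    obtain ⟨ya, yb, Cd, hya, hyb, hCds, hCdc⟩ := hCdB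
    simp only [Matrix.cons_val_zero, Matrix.cons_val_one] at hka hkb hKs hxa hxb hHds
    simp only [Matrix.cons_val_zero, Matrix.cons_val_one] at hva hvb hVds hya hyb hCds
    exact D.inward hm' h2 hN K (by omega) (by omega)
      (fun f hf => by have h := hKs f hf; exact ⟨by omega, by omega, by omega, by omega⟩) hKc
      Hd hxa (by omega) (fun f hf => by have h := hHds f hf; exact ⟨by omega, by omega, by omega, by omega⟩) hHdc
      Vd (by omega) (by omega) (fun f hf => by have h := hVds f hf; exact ⟨by omega, by omega, by omega, by omega⟩) hVdc
      Cd hya (by omega) (fun f hf => by have h := hCds f hf; exact ⟨by omega, by omega, by omega, by omega⟩) hCdc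

end Events



end Literature.Probability.Percolation

end
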